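import Summits.QuantumFields.YangMills.Theorems.BalabanUVNodesN15CurvedGluingSmoothCutDressedGluedDefect
import Summits.QuantumFields.YangMills.Theorems.BalabanUVNodesN15CurvedGluingLocalGaugesTwoGridFit
import HarnessLib

/-!
# Route «BalabanUVNodes» (cluster K4 «SpineRates»), Track-A DAG node N15 = NE2, BACKGROUND LAYER — THE TWO-GRID η-DEFECT OF THE GLUED LIVE-BACKGROUND PROPAGATOR, EACH CUBE IN ITS OWN PAIR OF
# SMALL-FIELD GAUGES ((3.34)–(3.35) with (3.42) ∕ Thm 3.14): file 45's capstone with PER-CUBE perturbations `V̂_k, V̂′_k`, PER-CUBE orthogonal site gauges `u_k, u′_k` agreeing across the block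
# map up to a displayed fit `o_W`, and far-defect slots — `U` need be small only cube by cube, on both grids

Cell `pub-ymgap`, seat `pub-ymgap-dag-n15-w3` (WIDTH SEAT 3∕3 on node N15, director-ym №197 ∕ HUMAN RULING D-0149; plan `W-SEAT-START-LIST.md` §n15 item 3 «LG-vector + background layers at
GENERAL small-field U» — forty-eighth piece; item (o1) of this seat's g4 HANDOFF, the DRESSED two-grid edition (COORD-3 I.38658: the generic gauge-transfer family is dag-n15-w2 g5's)).
`bears_on: R4∕N15 · K3⁸ SpineGivenEndpointR13SepCoPHV (stmt-QuantumFields-27366; K3⁷ 20544 aside — KEY MAP v2)`.  Filed `--kind proof --supports stmt-QuantumFields-27366 --as helper` —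
COUNT-NEUTRAL.  Theorems only; 0 `def`, 0 `sorry`.  Imports BY NAME file 45 `…SmoothCutDressedGluedDefect` (`gluedDefect_letters_nonneg`, `gluedDefect_r0a∕b∕c_nonneg`; through it files 34∕35
`hasMaj_smoothCutDressed_loc₂` ∕ `hasMaj_idef_smoothCutDressed_loc₂` ∕ `mulOp_comp_smoothCutDressed` ∕ `hasMaj(_idef)_(jet_)smoothCut_flat`, 38∕39 `hasMaj(_idef)_commOp_cubeOp_smoothCutDressed_in`,
33 `hasMaj(_idef)_dressedTail_out`, 23∕24 `hasMaj(_idef)_dressedV_pair`, 44 `weight_mul_exp_rate_mono`) and dag-n15-w2 g5 `…CurvedGluingLocalGaugesTwoGridFit` (`hasMaj_idef_glued_of_localGauges_fit`);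
nothing in the tree is modified, no landed name re-declared.

WHY.  NE2 is an η-RATE: the comparison of the live-background propagators at two spacings ([Balaban1985BackgroundPropagators] (3.42) p. 397, Thm 3.14 pp. 426–427).  With (3.34)–(3.35) p. 396 the
background is small only cube by cube, each enlarged cube in its own gauge — on the fine lattice `u′_□`, on the coarse one `u_□`, two independent small-field constructions that agree across the
block map only up to a fit.  File 45 compared the glued propagators of ONE global perturbation per grid; the companion one-grid file `…SmoothCutDressedGluedGauged` put each cube in its own gauge.
THIS FILE does both at once: per cube `k` the coarse∕fine gauges `u_k, u′_k : X, X′ → O(ι)` with `Σ_j|u′_k(x′)_{ij} − u_k(πx′)_{ij}| ≤ o_W` (and transposes), the coarse∕fine perturbations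
`V̂_k, V̂′_k` with letters `Re^{−δ_Vd}` and η-defect `oe^{−δ_Vd}`, the GLOBAL operators displayed in the gauges as `M_{u_k}ΔM_{u_kᵀ} = (Σ∇*∇ + W + N_L − V̂_k∘jet) + F_k`, `M_{u′_k}Δ′M_{u′_kᵀ} =
(Σ∇′*∇′ + W′ + N′_L − V̂′_k∘jet′) + F′_k`, the far defects entering through their two rows per grid (`θ_F`, `ε_F`) and the two η-defect rows `𝔇([F′_k, M_{h′_k}]X′_k, [F_k, M_{h_k}]X_k) ≤ 1_S(y′)r_{FK}e^{−ρ₃d}`,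
`𝔇(M_{h′_k}F′_kX′_k, M_{h_k}F_kX_k) ≤ 1_S(y)r_{FE}e^{−ρ₃d}`.  Per cube the dressed smooth-cut cubes and ALL their rows∕η-defects are formed IN THE CUBE's GAUGES by files 34∕35∕38∕39∕33 exactly as in
file 45 (at `V̂_k, V̂′_k`); the far-defect rows are added (`θ₀ ↦ θ₀ + θ_F`, `ε̄ ↦ ε̄ + ε_F`, `r₀ ↦ r₀ + r_{FK}`, `r_E ↦ r_E + r_{FE}`); dag-n15-w2 g5's fitted-gauge glue then gives ★★★
`hasMaj_idef_glueInv_smoothCutDressed_localGauges`: `𝔇(𝒢′, 𝒢) ≤ C·e^{−(ρ₃−2σ)d}` with `C` = file 45's constant at the letters `× |ι|²` plus the gauge-fit terms `2|ι|o_W·(β̄′, θ₀+θ_F, ε̄+ε_F)`.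

HONEST FRAMING ∕ LIMITS.  Composition of LANDED theorems over DISPLAYED rows on King's ∕ dag-n15-a's model carriers — the η-rate content of NE2 with (3.34)–(3.35)'s per-cube gauges as a
CONDITIONAL statement; the gauges and their fit, the `V̂`-letters and their η-defect, the covariance identities and the far-defect rows are HYPOTHESES (located producers: dag-n15-w2 g5's
axial-gauge ∕ `U(N)`-fit ∕ curved-species files; g0 `covLapM_trGaugeAct` + file 13 `covLapM_eq_lapOp`); nothing of [B5]∕[B6]∕[B9] asserted ((2.91)–(2.92), (2.133)–(2.136), (3.34)–(3.35), (3.42),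
(3.62)–(3.65), Thm 3.14 = SHAPES ∕ TEMPLATE).  NE2⁺ NOT PRINTED, NOT proved; N15 NOT discharged; K3⁸ OPEN, skeleton v6 untouched; counts of record UNMOVED (typed 28∕28 · discharged 5∕27); one
finite 𝕋⁴ at fixed ε — NOT infinite volume, NOT OS on ℝ⁴, NOT a mass gap, NOT Clay; R4 closes the conditional finite-𝕋⁴ rung `BalabanLadder.UV` only.  Restate-immune (no Theses import).
-/

set_option autoImplicit false

noncomputable section
open scoped BigOperators Matrix
open Finset

namespace Summit.QuantumFields.YangMills.BalabanUVNodes.N15.CurvedSpecies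

open Literature.MathematicalPhysics.QuantumFieldTheory.Balaban1983to89
open Literature.MathematicalPhysics.QuantumFieldTheory.Balaban1983to89.B11SectG (BlockNorm HasMaj RowSum)
open Literature.MathematicalPhysics.QuantumFieldTheory.Balaban1983to89.B6RandomWalk (Triangle254)
open Literature.MathematicalPhysics.QuantumFieldTheory.Balaban1983to89.T4EtaRateDefect (idef idef_add)
open Literature.MathematicalPhysics.QuantumFieldTheory.Balaban1983to89.T4EtaRateCoeffDefect (pull)
open Literature.MathematicalPhysics.QuantumFieldTheory.Balaban1983to89.B6Prop26Gluing (mulOp mulOp_apply ind ind_nonneg ind_le_one)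
open Summit.QuantumFields.YangMills.BalabanUVNodes.N15.MatrixSpecies (mmulOp liftBlk liftMap liftEquiv liftEquiv_apply liftEquiv_symm_apply)
open Summit.QuantumFields.YangMills.BalabanUVNodes.N15.BackgroundLayer (fgrad bgrad fgradAdj stack projO blkPair liftPair bgPropV)
open Summit.QuantumFields.YangMills.BalabanUVNodes.N15.Gluing (commOp lapOp parametrix remainder glueInv)

variable {X X' ι J K : Type} [Fintype X] [Fintype X'] [DecidableEq X] [DecidableEq X'] [Fintype ι] [DecidableEq ι] [Fintype J] [DecidableEq J] [Fintype K] {g : B6.Geometry}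
  (blk : X → g.Site) (π : X' → X) (τ : J → X ≃ X) (τ' : J → X' ≃ X') (n n' : ℝ) {σ cr : ℝ}
  {N : K → (X × ι → ℝ) →ₗ[ℝ] (X × ι → ℝ)} {N' : K → (X' × ι → ℝ) →ₗ[ℝ] (X' × ι → ℝ)} {V : K → ((X × ι) × Option (J ⊕ J) → ℝ) →ₗ[ℝ] (X × ι → ℝ)}
  {V' : K → ((X' × ι) × Option (J ⊕ J) → ℝ) →ₗ[ℝ] (X' × ι → ℝ)} {Δ W NL : (X × ι → ℝ) →ₗ[ℝ] (X × ι → ℝ)} {Δ' W' NL' : (X' × ι → ℝ) →ₗ[ℝ] (X' × ι → ℝ)}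
  {F : K → (X × ι → ℝ) →ₗ[ℝ] (X × ι → ℝ)} {F' : K → (X' × ι → ℝ) →ₗ[ℝ] (X' × ι → ℝ)} {ug : K → X → Matrix ι ι ℝ} {ug' : K → X' → Matrix ι ι ℝ}
  {χX χtX ψX hX : K → X → ℝ} {χX' χtX' ψX' hX' : K → X' → ℝ} {Sk : K → Set g.Site} {hb : K → g.Site → ℝ}
  {β β₁ ct m₀ m₁ oχ oχ₁ oχ₂ δ : ℝ}

/-- ★★★ **THE TWO-GRID η-DEFECT OF THE GLUED LIVE-BACKGROUND PROPAGATOR FROM PER-CUBE SMALL-FIELD GAUGE PAIRS**: file 45's capstone with every cube `k` carrying ITS OWN orthogonal site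
gauges `u_k` (coarse) ∕ `u′_k` (fine), agreeing across `π` up to the max-row-sum fit `o_W`, ITS OWN perturbations `V̂_k` ∕ `V̂′_k` of the jets (letters `R`, η-defect `o`), both grids' GLOBAL
operators read in those gauges as the cube's model operators plus far defects `F_k` ∕ `F′_k` (rows `θ_F, ε_F`, η-defects `r_{FK}, r_{FE}` displayed); files 34∕35∕38∕39∕33 BY NAME per
cube at `V̂_k, V̂′_k`, then ONE application of dag-n15-w2 g5's `hasMaj_idef_glued_of_localGauges_fit`: `𝔇(𝒢′, 𝒢) ≤` file 45's letter at (`|ι|²β̄′`, `|ι|²(θ₀+θ_F)`, `|ι|²(ε̄+ε_F)`,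
`|ι|²A_D + 2|ι|o_Wβ̄′`, `|ι|²(r₀+r_{FK}) + 2|ι|o_W(θ₀+θ_F)`, `|ι|²(r_E+r_{FE}) + 2|ι|o_W(ε̄+ε_F)`, `oo`, `N_ov`) — written out below.
[cite: Balaban1985BackgroundPropagators, (3.34)–(3.35) p.396, (3.42) p.397, Thm 3.14 pp.426–427 (template), (3.62)–(3.65) pp.402–403; Balaban1984PropagatorsII, (2.91) p.239, (2.133)–(2.136) p.247 (mechanism)] -/
theorem hasMaj_idef_glueInv_smoothCutDressed_localGauges (htri : Triangle254 g) (hd : ∀ a b : g.Site, 0 ≤ g.dist a b) (hd0 : ∀ y : g.Site, g.dist y y = 0)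
    (hsymm : ∀ y y', g.dist y y' = g.dist y' y) (hrow : RowSum g σ cr) (hσ : 0 ≤ σ) (hcr : 0 ≤ cr)
    {ρ₁ ρ₂ ρ₃ ρN ρT δV ε R o c₁ c₂ o₁ o₂ rW θW cN rN ℓ ω d₁ oo ε₀ rF Nov θF εF rFK rFE oW : ℝ} (hβ : 0 ≤ β) (hβ₁ : 0 ≤ β₁) (hct : 0 ≤ ct) (hm₀ : 0 ≤ m₀) (hm₁ : 0 ≤ m₁)
    (hoχ : 0 ≤ oχ) (hoχ₁ : 0 ≤ oχ₁) (hoχ₂ : 0 ≤ oχ₂) (hR : 0 ≤ R) (ho : 0 ≤ o) (hσρ : σ ≤ ρ₁) (hρ₁V : ρ₁ ≤ δV) (hρ₁G : ρ₁ + σ ≤ δ) (hρ₂ : 0 ≤ ρ₂) (hρ₂₁ : ρ₂ + σ ≤ ρ₁)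
    (hρ₂T : ρ₂ + σ ≤ ρT) (hρ₃ : 0 ≤ ρ₃) (hρ₃₂ : ρ₃ ≤ ρ₂) (hρ₃V : ρ₃ + σ ≤ δV - ε) (hρ₃N : ρ₃ + σ ≤ ρN) (hσρ₃ : 2 * σ ≤ ρ₃) (hε : 0 < ε) (hc₁ : 0 ≤ c₁) (hc₂ : 0 ≤ c₂)
    (ho₁ : 0 ≤ o₁) (ho₂ : 0 ≤ o₂) (hrW : 0 ≤ rW) (hθW : 0 ≤ θW) (hcN : 0 ≤ cN) (hrN : 0 ≤ rN) (hℓ : 0 ≤ ℓ) (hω : 0 ≤ ω) (hd₁ : 0 ≤ d₁) (hoo : 0 ≤ oo) (hε₀ : 0 ≤ ε₀)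
    (hrF : 0 ≤ rF) (hNov : 0 ≤ Nov) (hn : 0 < n) (hn' : 0 < n')
    (hSχ : ∀ k, ∀ x, (χX k) x ≠ 0 → blk x ∈ (Sk k)) (hSψ : ∀ k, ∀ x, (ψX k) x ≠ 0 → blk x ∈ (Sk k)) (hSχ' : ∀ k, ∀ x', (χX' k) x' ≠ 0 → blk (π x') ∈ (Sk k)) (hSψ' : ∀ k, ∀ x', (ψX' k) x' ≠ 0 → blk (π x') ∈ (Sk k))
    -- coarse bump data
    (hχt : ∀ k, ∀ x, |(χtX k) x| ≤ 1)
    (hdχt : ∀ k, ∀ μ p, |fgrad n (liftEquiv (τ μ) ι) (fun p : X × ι => (χtX k) p.1) p| ≤ ct) (hdχtb : ∀ k, ∀ μ p, |bgrad n (liftEquiv (τ μ) ι) (fun p : X × ι => (χtX k) p.1) p| ≤ ct)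
    (hsub : ∀ k, mulOp (fun p : X × ι => (χtX k) p.1) ∘ₗ mulOp (fun p : X × ι => (χX k) p.1) = mulOp (fun p : X × ι => (χtX k) p.1))
    (hχ : ∀ k, mulOp (fun p : X × ι => (χX k) p.1) ∘ₗ mulOp (fun p : X × ι => (χtX k) p.1) = mulOp (fun p : X × ι => (χtX k) p.1))
    (hs : ∀ k, ∀ μ, mulOp ((fun p : X × ι => (χtX k) p.1) ∘ (liftEquiv (τ μ) ι)) ∘ₗ mulOp (fun p : X × ι => (χX k) p.1) = mulOp ((fun p : X × ι => (χtX k) p.1) ∘ (liftEquiv (τ μ) ι)))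
    (hsb : ∀ k, ∀ μ, mulOp ((fun p : X × ι => (χtX k) p.1) ∘ (liftEquiv (τ μ) ι).symm) ∘ₗ mulOp (fun p : X × ι => (χX k) p.1) = mulOp ((fun p : X × ι => (χtX k) p.1) ∘ (liftEquiv (τ μ) ι).symm))
    (hdd : ∀ k, ∀ μ, mulOp (fgrad n (liftEquiv (τ μ) ι) (fun p : X × ι => (χtX k) p.1)) ∘ₗ mulOp (fun p : X × ι => (χX k) p.1) = mulOp (fgrad n (liftEquiv (τ μ) ι) (fun p : X × ι => (χtX k) p.1)))
    (hddb : ∀ k, ∀ μ, mulOp (bgrad n (liftEquiv (τ μ) ι) (fun p : X × ι => (χtX k) p.1)) ∘ₗ mulOp (fun p : X × ι => (χX k) p.1) = mulOp (bgrad n (liftEquiv (τ μ) ι) (fun p : X × ι => (χtX k) p.1)))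
    (hNψ : ∀ k, (N k) ∘ₗ mulOp (fun p : X × ι => (ψX k) p.1) = (N k))
    -- fine bump data
    (hχt' : ∀ k, ∀ x', |(χtX' k) x'| ≤ 1)
    (hdχt' : ∀ k, ∀ μ p', |fgrad n' (liftEquiv (τ' μ) ι) (fun p' : X' × ι => (χtX' k) p'.1) p'| ≤ ct) (hdχtb' : ∀ k, ∀ μ p', |bgrad n' (liftEquiv (τ' μ) ι) (fun p' : X' × ι => (χtX' k) p'.1) p'| ≤ ct)
    (hsub' : ∀ k, mulOp (fun p : X' × ι => (χtX' k) p.1) ∘ₗ mulOp (fun p : X' × ι => (χX' k) p.1) = mulOp (fun p : X' × ι => (χtX' k) p.1))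
    (hχ' : ∀ k, mulOp (fun p : X' × ι => (χX' k) p.1) ∘ₗ mulOp (fun p : X' × ι => (χtX' k) p.1) = mulOp (fun p : X' × ι => (χtX' k) p.1))
    (hs' : ∀ k, ∀ μ, mulOp ((fun p' : X' × ι => (χtX' k) p'.1) ∘ (liftEquiv (τ' μ) ι)) ∘ₗ mulOp (fun p' : X' × ι => (χX' k) p'.1) = mulOp ((fun p' : X' × ι => (χtX' k) p'.1) ∘ (liftEquiv (τ' μ) ι)))
    (hsb' : ∀ k, ∀ μ, mulOp ((fun p' : X' × ι => (χtX' k) p'.1) ∘ (liftEquiv (τ' μ) ι).symm) ∘ₗ mulOp (fun p' : X' × ι => (χX' k) p'.1) =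
      mulOp ((fun p' : X' × ι => (χtX' k) p'.1) ∘ (liftEquiv (τ' μ) ι).symm))
    (hdd' : ∀ k, ∀ μ, mulOp (fgrad n' (liftEquiv (τ' μ) ι) (fun p' : X' × ι => (χtX' k) p'.1)) ∘ₗ mulOp (fun p' : X' × ι => (χX' k) p'.1) = mulOp (fgrad n' (liftEquiv (τ' μ) ι) (fun p' : X' × ι => (χtX' k) p'.1)))
    (hddb' : ∀ k, ∀ μ, mulOp (bgrad n' (liftEquiv (τ' μ) ι) (fun p' : X' × ι => (χtX' k) p'.1)) ∘ₗ mulOp (fun p' : X' × ι => (χX' k) p'.1) = mulOp (bgrad n' (liftEquiv (τ' μ) ι) (fun p' : X' × ι => (χtX' k) p'.1)))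
    (hNψ' : ∀ k, (N' k) ∘ₗ mulOp (fun p : X' × ι => (ψX' k) p.1) = (N' k))
    -- fits of the bumps across `π`
    (hfitχ : ∀ k, ∀ x', |(χtX' k) x' - (χtX k) (π x')| ≤ oχ)
    (hfit₁ : ∀ k, ∀ μ p', |((fun p' : X' × ι => (χtX' k) p'.1) ∘ (liftEquiv (τ' μ) ι)) p' - ((fun p : X × ι => (χtX k) p.1) ∘ (liftEquiv (τ μ) ι)) (liftMap π ι p')| ≤ oχ₁)
    (hfit₁b : ∀ k, ∀ μ p', |((fun p' : X' × ι => (χtX' k) p'.1) ∘ (liftEquiv (τ' μ) ι).symm) p' - ((fun p : X × ι => (χtX k) p.1) ∘ (liftEquiv (τ μ) ι).symm) (liftMap π ι p')| ≤ oχ₁)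
    (hfit₂ : ∀ k, ∀ μ p', |fgrad n' (liftEquiv (τ' μ) ι) (fun p' : X' × ι => (χtX' k) p'.1) p' - fgrad n (liftEquiv (τ μ) ι) (fun p : X × ι => (χtX k) p.1) (liftMap π ι p')| ≤ oχ₂)
    (hfit₂b : ∀ k, ∀ μ p', |bgrad n' (liftEquiv (τ' μ) ι) (fun p' : X' × ι => (χtX' k) p'.1) p' - bgrad n (liftEquiv (τ μ) ι) (fun p : X × ι => (χtX k) p.1) (liftMap π ι p')| ≤ oχ₂)
    -- cut rows and their defects
    (hcut : ∀ k, HasMaj (BlockNorm.ofBlocks g (liftBlk blk ι)) (BlockNorm.ofBlocks g (liftBlk blk ι)) (mulOp (fun p : X × ι => (χX k) p.1) ∘ₗ (N k))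
      (fun y y' => ind (Sk k) y * ind (Sk k) y' * (β * Real.exp (-(δ * g.dist y y')))))
    (hcutF : ∀ k, ∀ μ, HasMaj (BlockNorm.ofBlocks g (liftBlk blk ι)) (BlockNorm.ofBlocks g (liftBlk blk ι)) (mulOp (fun p : X × ι => (χX k) p.1) ∘ₗ (fgrad n (liftEquiv (τ μ) ι) ∘ₗ (N k)))
      (fun y y' => ind (Sk k) y * ind (Sk k) y' * (β₁ * Real.exp (-(δ * g.dist y y')))))
    (hcutB : ∀ k, ∀ μ, HasMaj (BlockNorm.ofBlocks g (liftBlk blk ι)) (BlockNorm.ofBlocks g (liftBlk blk ι)) (mulOp (fun p : X × ι => (χX k) p.1) ∘ₗ (bgrad n (liftEquiv (τ μ) ι) ∘ₗ (N k)))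
      (fun y y' => ind (Sk k) y * ind (Sk k) y' * (β₁ * Real.exp (-(δ * g.dist y y')))))
    (hcut' : ∀ k, HasMaj (BlockNorm.ofBlocks g (liftBlk (blk ∘ π) ι)) (BlockNorm.ofBlocks g (liftBlk (blk ∘ π) ι)) (mulOp (fun p : X' × ι => (χX' k) p.1) ∘ₗ (N' k))
      (fun y y' => ind (Sk k) y * ind (Sk k) y' * (β * Real.exp (-(δ * g.dist y y')))))
    (hcutF' : ∀ k, ∀ μ, HasMaj (BlockNorm.ofBlocks g (liftBlk (blk ∘ π) ι)) (BlockNorm.ofBlocks g (liftBlk (blk ∘ π) ι)) (mulOp (fun p : X' × ι => (χX' k) p.1) ∘ₗ (fgrad n' (liftEquiv (τ' μ) ι) ∘ₗ (N' k)))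
      (fun y y' => ind (Sk k) y * ind (Sk k) y' * (β₁ * Real.exp (-(δ * g.dist y y')))))
    (hcutB' : ∀ k, ∀ μ, HasMaj (BlockNorm.ofBlocks g (liftBlk (blk ∘ π) ι)) (BlockNorm.ofBlocks g (liftBlk (blk ∘ π) ι)) (mulOp (fun p : X' × ι => (χX' k) p.1) ∘ₗ (bgrad n' (liftEquiv (τ' μ) ι) ∘ₗ (N' k)))
      (fun y y' => ind (Sk k) y * ind (Sk k) y' * (β₁ * Real.exp (-(δ * g.dist y y')))))
    (hDcut : ∀ k, HasMaj (BlockNorm.ofBlocks g (liftBlk blk ι)) (BlockNorm.ofBlocks g (liftBlk blk ι ∘ liftMap π ι))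
      (idef (pull (liftMap π ι)) (pull (liftMap π ι)) (mulOp (fun p : X' × ι => (χX' k) p.1) ∘ₗ (N' k)) (mulOp (fun p : X × ι => (χX k) p.1) ∘ₗ (N k)))
      (fun y y' => ind (Sk k) y * ind (Sk k) y' * (m₀ * Real.exp (-(δ * g.dist y y')))))
    (hDcutF : ∀ k, ∀ μ, HasMaj (BlockNorm.ofBlocks g (liftBlk blk ι)) (BlockNorm.ofBlocks g (liftBlk blk ι ∘ liftMap π ι))
      (idef (pull (liftMap π ι)) (pull (liftMap π ι)) (mulOp (fun p : X' × ι => (χX' k) p.1) ∘ₗ (fgrad n' (liftEquiv (τ' μ) ι) ∘ₗ (N' k))) (mulOp (fun p : X × ι => (χX k) p.1) ∘ₗ (fgrad n (liftEquiv (τ μ) ι) ∘ₗ (N k))))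
      (fun y y' => ind (Sk k) y * ind (Sk k) y' * (m₁ * Real.exp (-(δ * g.dist y y')))))
    (hDcutB : ∀ k, ∀ μ, HasMaj (BlockNorm.ofBlocks g (liftBlk blk ι)) (BlockNorm.ofBlocks g (liftBlk blk ι ∘ liftMap π ι))
      (idef (pull (liftMap π ι)) (pull (liftMap π ι)) (mulOp (fun p : X' × ι => (χX' k) p.1) ∘ₗ (bgrad n' (liftEquiv (τ' μ) ι) ∘ₗ (N' k))) (mulOp (fun p : X × ι => (χX k) p.1) ∘ₗ (bgrad n (liftEquiv (τ μ) ι) ∘ₗ (N k))))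
      (fun y y' => ind (Sk k) y * ind (Sk k) y' * (m₁ * Real.exp (-(δ * g.dist y y')))))
    -- the jet pieces' reversed insertions (output cut-offs), both grids
    (hs2 : ∀ k, ∀ μ, mulOp (fun p : X × ι => (χX k) p.1) ∘ₗ mulOp ((fun p : X × ι => (χtX k) p.1) ∘ (liftEquiv (τ μ) ι)) = mulOp ((fun p : X × ι => (χtX k) p.1) ∘ (liftEquiv (τ μ) ι)))
    (hsb2 : ∀ k, ∀ μ, mulOp (fun p : X × ι => (χX k) p.1) ∘ₗ mulOp ((fun p : X × ι => (χtX k) p.1) ∘ (liftEquiv (τ μ) ι).symm) = mulOp ((fun p : X × ι => (χtX k) p.1) ∘ (liftEquiv (τ μ) ι).symm))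
    (hdd2 : ∀ k, ∀ μ, mulOp (fun p : X × ι => (χX k) p.1) ∘ₗ mulOp (fgrad n (liftEquiv (τ μ) ι) (fun p : X × ι => (χtX k) p.1)) = mulOp (fgrad n (liftEquiv (τ μ) ι) (fun p : X × ι => (χtX k) p.1)))
    (hddb2 : ∀ k, ∀ μ, mulOp (fun p : X × ι => (χX k) p.1) ∘ₗ mulOp (bgrad n (liftEquiv (τ μ) ι) (fun p : X × ι => (χtX k) p.1)) = mulOp (bgrad n (liftEquiv (τ μ) ι) (fun p : X × ι => (χtX k) p.1)))
    (hs2' : ∀ k, ∀ μ, mulOp (fun p' : X' × ι => (χX' k) p'.1) ∘ₗ mulOp ((fun p' : X' × ι => (χtX' k) p'.1) ∘ (liftEquiv (τ' μ) ι)) = mulOp ((fun p' : X' × ι => (χtX' k) p'.1) ∘ (liftEquiv (τ' μ) ι)))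
    (hsb2' : ∀ k, ∀ μ, mulOp (fun p' : X' × ι => (χX' k) p'.1) ∘ₗ mulOp ((fun p' : X' × ι => (χtX' k) p'.1) ∘ (liftEquiv (τ' μ) ι).symm) =
      mulOp ((fun p' : X' × ι => (χtX' k) p'.1) ∘ (liftEquiv (τ' μ) ι).symm))
    (hdd2' : ∀ k, ∀ μ, mulOp (fun p' : X' × ι => (χX' k) p'.1) ∘ₗ mulOp (fgrad n' (liftEquiv (τ' μ) ι) (fun p' : X' × ι => (χtX' k) p'.1)) = mulOp (fgrad n' (liftEquiv (τ' μ) ι) (fun p' : X' × ι => (χtX' k) p'.1)))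
    (hddb2' : ∀ k, ∀ μ, mulOp (fun p' : X' × ι => (χX' k) p'.1) ∘ₗ mulOp (bgrad n' (liftEquiv (τ' μ) ι) (fun p' : X' × ι => (χtX' k) p'.1)) = mulOp (bgrad n' (liftEquiv (τ' μ) ι) (fun p' : X' × ι => (χtX' k) p'.1)))
    -- per cube, IN THE CUBE's GAUGES: the perturbations `V̂_k` (coarse), `V̂′_k` (fine) of the jets, their letters and their η-defect across `π`
    (hV : ∀ k, HasMaj (BlockNorm.ofBlocks g (blkPair (liftBlk blk ι))) (BlockNorm.ofBlocks g (liftBlk blk ι)) (V k) (fun y y' => R * Real.exp (-(δV * g.dist y y'))))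
    (hV' : ∀ k, HasMaj (BlockNorm.ofBlocks g (blkPair (liftBlk (blk ∘ π) ι))) (BlockNorm.ofBlocks g (liftBlk (blk ∘ π) ι)) (V' k) (fun y y' => R * Real.exp (-(δV * g.dist y y'))))
    (hDV : ∀ k, HasMaj (BlockNorm.ofBlocks g (blkPair (liftBlk blk ι))) (BlockNorm.ofBlocks g (liftBlk (blk ∘ π) ι))
      (idef (pull (liftPair (liftMap π ι))) (pull (liftMap π ι)) (V' k) (V k)) (fun y y' => o * Real.exp (-(δV * g.dist y y'))))
    (hq : (β + (β₁ + ct * β)) * (R * cr) * cr < 1)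
    (hh1 : ∀ k, ∀ μ p, |fgrad n (liftEquiv (τ μ) ι) (fun p : X × ι => hX k p.1) p| ≤ c₁) (hh1b : ∀ k, ∀ μ p, |bgrad n (liftEquiv (τ μ) ι) (fun p : X × ι => hX k p.1) p| ≤ c₁)
    (hh1' : ∀ k, ∀ μ p', |fgrad n' (liftEquiv (τ' μ) ι) (fun p : X' × ι => hX' k p.1) p'| ≤ c₁) (hh1b' : ∀ k, ∀ μ p', |bgrad n' (liftEquiv (τ' μ) ι) (fun p : X' × ι => hX' k p.1) p'| ≤ c₁)
    (hh2' : ∀ k, ∀ μ p', |fgradAdj n' (liftEquiv (τ' μ) ι) (fgrad n' (liftEquiv (τ' μ) ι) (fun p : X' × ι => hX' k p.1)) p'| ≤ c₂)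
    (hf1 : ∀ k, ∀ μ p', |fgrad n' (liftEquiv (τ' μ) ι) (fun p : X' × ι => hX' k p.1) p' - fgrad n (liftEquiv (τ μ) ι) (fun p : X × ι => hX k p.1) (liftMap π ι p')| ≤ o₁)
    (hf1b : ∀ k, ∀ μ p', |bgrad n' (liftEquiv (τ' μ) ι) (fun p : X' × ι => hX' k p.1) p' - bgrad n (liftEquiv (τ μ) ι) (fun p : X × ι => hX k p.1) (liftMap π ι p')| ≤ o₁)
    (hf2 : ∀ k, ∀ μ p', |fgradAdj n' (liftEquiv (τ' μ) ι) (fgrad n' (liftEquiv (τ' μ) ι) (fun p : X' × ι => hX' k p.1)) p' - fgradAdj n (liftEquiv (τ μ) ι) (fgrad n (liftEquiv (τ μ) ι) (fun p : X × ι => hX k p.1)) (liftMap π ι p')| ≤ o₂)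
    (hLip : ∀ k, ∀ y y', |(hb k) y - (hb k) y'| ≤ ℓ * g.dist y y') (hrh : ∀ k (p : X × ι), |hX k p.1 - (hb k) (liftBlk blk ι p)| ≤ ω) (hrh' : ∀ k (p' : X' × ι), |hX' k p'.1 - (hb k) (liftBlk (blk ∘ π) ι p')| ≤ ω)
    (hfh : ∀ k (p' : X' × ι), |hX' k p'.1 - hX k (π p'.1)| ≤ oo) (hstep : ∀ μ x, g.dist (blk (τ μ x)) (blk x) ≤ d₁) (hstep' : ∀ μ x', g.dist (blk (π (τ' μ x'))) (blk (π x')) ≤ d₁)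
    (hDW : ∀ k, HasMaj (BlockNorm.ofBlocks g (liftBlk blk ι)) (BlockNorm.ofBlocks g (liftBlk (blk ∘ π) ι))
      (idef (pull (liftMap π ι)) (pull (liftMap π ι)) (commOp W' (fun p : X' × ι => hX' k p.1) ∘ₗ (projO none ∘ₗ bgPropV (stack (mulOp (fun p : X' × ι => (χtX' k) p.1) ∘ₗ (N' k))
          (fun j => Sum.elim (fun μ => fgrad n' (liftEquiv (τ' μ) ι)) (fun μ => bgrad n' (liftEquiv (τ' μ) ι)) j ∘ₗ (mulOp (fun p : X' × ι => (χtX' k) p.1) ∘ₗ (N' k)))) (V' k))) (commOp W (fun p : X × ι => hX k p.1) ∘ₗ (projO none ∘ₗ bgPropV (stack (mulOp (fun p : X × ι => (χtX k) p.1) ∘ₗ (N k))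
          (fun j => Sum.elim (fun μ => fgrad n (liftEquiv (τ μ) ι)) (fun μ => bgrad n (liftEquiv (τ μ) ι)) j ∘ₗ (mulOp (fun p : X × ι => (χtX k) p.1) ∘ₗ (N k)))) (V k))))
      (fun y y' => ind (Sk k) y * ind (Sk k) y' * (rW * Real.exp (-(ρ₂ * g.dist y y')))))
    (hKN' : ∀ k, HasMaj (BlockNorm.ofBlocks g (liftBlk (blk ∘ π) ι)) (BlockNorm.ofBlocks g (liftBlk (blk ∘ π) ι)) (commOp NL' (fun p : X' × ι => hX' k p.1)) (fun y y' => cN * Real.exp (-(ρN * g.dist y y'))))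
    (hDKN : ∀ k, HasMaj (BlockNorm.ofBlocks g (liftBlk blk ι)) (BlockNorm.ofBlocks g (liftBlk (blk ∘ π) ι))
      (idef (pull (liftMap π ι)) (pull (liftMap π ι)) (commOp NL' (fun p : X' × ι => hX' k p.1)) (commOp NL (fun p : X × ι => hX k p.1))) (fun y y' => rN * Real.exp (-(ρN * g.dist y y'))))

    -- per cube, beyond file 39's data: the coarse second differences, the one-grid `W`-rows at both grids, the coarse `[N_L, M_h]` letter, the partition's sizes and cut support, the tail rows and their defect
    (hh2 : ∀ k, ∀ μ p, |fgradAdj n (liftEquiv (τ μ) ι) (fgrad n (liftEquiv (τ μ) ι) (fun p : X × ι => hX k p.1)) p| ≤ c₂)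
    (hW : ∀ k, HasMaj (BlockNorm.ofBlocks g (liftBlk blk ι)) (BlockNorm.ofBlocks g (liftBlk blk ι)) (commOp W (fun p : X × ι => hX k p.1) ∘ₗ (projO none ∘ₗ bgPropV (stack (mulOp (fun p : X × ι => χtX k p.1) ∘ₗ N k)
          (fun j => Sum.elim (fun μ => fgrad n (liftEquiv (τ μ) ι)) (fun μ => bgrad n (liftEquiv (τ μ) ι)) j ∘ₗ (mulOp (fun p : X × ι => χtX k p.1) ∘ₗ N k))) (V k)))
      (fun y y' => ind (Sk k) y * ind (Sk k) y' * (θW * Real.exp (-(ρ₂ * g.dist y y')))))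
    (hW' : ∀ k, HasMaj (BlockNorm.ofBlocks g (liftBlk (blk ∘ π) ι)) (BlockNorm.ofBlocks g (liftBlk (blk ∘ π) ι)) (commOp W' (fun p : X' × ι => hX' k p.1) ∘ₗ (projO none ∘ₗ bgPropV (stack (mulOp (fun p : X' × ι => χtX' k p.1) ∘ₗ N' k)
          (fun j => Sum.elim (fun μ => fgrad n' (liftEquiv (τ' μ) ι)) (fun μ => bgrad n' (liftEquiv (τ' μ) ι)) j ∘ₗ (mulOp (fun p : X' × ι => χtX' k p.1) ∘ₗ N' k))) (V' k)))
      (fun y y' => ind (Sk k) y * ind (Sk k) y' * (θW * Real.exp (-(ρ₂ * g.dist y y')))))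
    (hKN : ∀ k, HasMaj (BlockNorm.ofBlocks g (liftBlk blk ι)) (BlockNorm.ofBlocks g (liftBlk blk ι)) (commOp NL (fun p : X × ι => hX k p.1)) (fun y y' => cN * Real.exp (-(ρN * g.dist y y'))))
    (hhabs : ∀ k x, |hX k x| ≤ 1) (hhabs' : ∀ k x', |hX' k x'| ≤ 1)
    (hhcut : ∀ k, mulOp (fun p : X × ι => hX k p.1) ∘ₗ mulOp (fun p : X × ι => χX k p.1) = mulOp (fun p : X × ι => hX k p.1)) (hhcut' : ∀ k, mulOp (fun p : X' × ι => hX' k p.1) ∘ₗ mulOp (fun p : X' × ι => χX' k p.1) = mulOp (fun p : X' × ι => hX' k p.1))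
    (hN : ∀ b, ∑ k, ind (Sk k) b ≤ Nov)
    (hT : ∀ k, HasMaj (BlockNorm.ofBlocks g (liftBlk blk ι)) (BlockNorm.ofBlocks g (liftBlk blk ι)) ((-(mulOp (fun p : X × ι => hX k p.1) ∘ₗ NL ∘ₗ mulOp (1 - fun p : X × ι => χtX k p.1))) ∘ₗ N k) (fun y y' => ind (Sk k) y * ind (Sk k) y' * (ε₀ * Real.exp (-(ρT * g.dist y y')))))
    (hT' : ∀ k, HasMaj (BlockNorm.ofBlocks g (liftBlk (blk ∘ π) ι)) (BlockNorm.ofBlocks g (liftBlk (blk ∘ π) ι)) ((-(mulOp (fun p : X' × ι => hX' k p.1) ∘ₗ NL' ∘ₗ mulOp (1 - fun p : X' × ι => χtX' k p.1))) ∘ₗ N' k) (fun y y' => ind (Sk k) y * ind (Sk k) y' * (ε₀ * Real.exp (-(ρT * g.dist y y')))))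
    (hDT : ∀ k, HasMaj (BlockNorm.ofBlocks g (liftBlk blk ι)) (BlockNorm.ofBlocks g (liftBlk (blk ∘ π) ι)) (idef (pull (liftMap π ι)) (pull (liftMap π ι)) ((-(mulOp (fun p : X' × ι => hX' k p.1) ∘ₗ NL' ∘ₗ mulOp (1 - fun p : X' × ι => χtX' k p.1))) ∘ₗ N' k) ((-(mulOp (fun p : X × ι => hX k p.1) ∘ₗ NL ∘ₗ mulOp (1 - fun p : X × ι => χtX k p.1))) ∘ₗ N k)) (fun y y' => ind (Sk k) y * ind (Sk k) y' * (rF * Real.exp (-(ρT * g.dist y y')))))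
    -- per cube: the ORTHOGONAL SITE GAUGE PAIR `u_k` (coarse), `u′_k` (fine) of (3.35) with max-row-sum fits `o_W` across `π`; both grids' GLOBAL operators read in them = the cube's model operators up to far defects `F_k`, `F′_k`; the far defects' rows against the cubes and their η-defects
    (hug : ∀ k x, ug k x * (ug k x)ᵀ = 1) (hug' : ∀ k x, (ug k x)ᵀ * ug k x = 1) (hugf : ∀ k x', ug' k x' * (ug' k x')ᵀ = 1) (hugf' : ∀ k x', (ug' k x')ᵀ * ug' k x' = 1)
    (hfitW : ∀ k x' i, ∑ j, |ug' k x' i j - ug k (π x') i j| ≤ oW) (hfitWT : ∀ k x' i, ∑ j, |(ug' k x')ᵀ i j - (ug k (π x'))ᵀ i j| ≤ oW) (hoW : 0 ≤ oW) (hθF : 0 ≤ θF) (hεF : 0 ≤ εF) (hrFK : 0 ≤ rFK) (hrFE : 0 ≤ rFE)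
    (hcov : ∀ k, mmulOp (ug k) ∘ₗ Δ ∘ₗ mmulOp (fun x => (ug k x)ᵀ) = (lapOp n (fun μ => liftEquiv (τ μ) ι) W + NL - V k ∘ₗ stack LinearMap.id (fun j => Sum.elim (fun μ => fgrad n (liftEquiv (τ μ) ι)) (fun μ => bgrad n (liftEquiv (τ μ) ι)) j)) + F k)
    (hcov' : ∀ k, mmulOp (ug' k) ∘ₗ Δ' ∘ₗ mmulOp (fun x' => (ug' k x')ᵀ) = (lapOp n' (fun μ => liftEquiv (τ' μ) ι) W' + NL' - V' k ∘ₗ stack LinearMap.id (fun j => Sum.elim (fun μ => fgrad n' (liftEquiv (τ' μ) ι)) (fun μ => bgrad n' (liftEquiv (τ' μ) ι)) j)) + F' k)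
    (hFK : ∀ k, HasMaj (BlockNorm.ofBlocks g (liftBlk blk ι)) (BlockNorm.ofBlocks g (liftBlk blk ι)) (commOp (F k) (fun p : X × ι => hX k p.1) ∘ₗ (projO none ∘ₗ bgPropV (stack (mulOp (fun p : X × ι => χtX k p.1) ∘ₗ N k) (fun j => Sum.elim (fun μ => fgrad n (liftEquiv (τ μ) ι)) (fun μ => bgrad n (liftEquiv (τ μ) ι)) j ∘ₗ (mulOp (fun p : X × ι => χtX k p.1) ∘ₗ N k))) (V k)))
      (fun y y' => ind (Sk k) y' * (θF * Real.exp (-(ρ₃ * g.dist y y')))))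
    (hFK' : ∀ k, HasMaj (BlockNorm.ofBlocks g (liftBlk (blk ∘ π) ι)) (BlockNorm.ofBlocks g (liftBlk (blk ∘ π) ι)) (commOp (F' k) (fun p : X' × ι => hX' k p.1) ∘ₗ (projO none ∘ₗ bgPropV (stack (mulOp (fun p : X' × ι => χtX' k p.1) ∘ₗ N' k) (fun j => Sum.elim (fun μ => fgrad n' (liftEquiv (τ' μ) ι)) (fun μ => bgrad n' (liftEquiv (τ' μ) ι)) j ∘ₗ (mulOp (fun p : X' × ι => χtX' k p.1) ∘ₗ N' k))) (V' k)))
      (fun y y' => ind (Sk k) y' * (θF * Real.exp (-(ρ₃ * g.dist y y')))))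
    (hFX : ∀ k, HasMaj (BlockNorm.ofBlocks g (liftBlk blk ι)) (BlockNorm.ofBlocks g (liftBlk blk ι)) (mulOp (fun p : X × ι => hX k p.1) ∘ₗ F k ∘ₗ (projO none ∘ₗ bgPropV (stack (mulOp (fun p : X × ι => χtX k p.1) ∘ₗ N k) (fun j => Sum.elim (fun μ => fgrad n (liftEquiv (τ μ) ι)) (fun μ => bgrad n (liftEquiv (τ μ) ι)) j ∘ₗ (mulOp (fun p : X × ι => χtX k p.1) ∘ₗ N k))) (V k)))
      (fun y y' => ind (Sk k) y * (εF * Real.exp (-(ρ₃ * g.dist y y')))))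
    (hFX' : ∀ k, HasMaj (BlockNorm.ofBlocks g (liftBlk (blk ∘ π) ι)) (BlockNorm.ofBlocks g (liftBlk (blk ∘ π) ι)) (mulOp (fun p : X' × ι => hX' k p.1) ∘ₗ F' k ∘ₗ (projO none ∘ₗ bgPropV (stack (mulOp (fun p : X' × ι => χtX' k p.1) ∘ₗ N' k) (fun j => Sum.elim (fun μ => fgrad n' (liftEquiv (τ' μ) ι)) (fun μ => bgrad n' (liftEquiv (τ' μ) ι)) j ∘ₗ (mulOp (fun p : X' × ι => χtX' k p.1) ∘ₗ N' k))) (V' k)))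
      (fun y y' => ind (Sk k) y * (εF * Real.exp (-(ρ₃ * g.dist y y')))))
    (hDFK : ∀ k, HasMaj (BlockNorm.ofBlocks g (liftBlk blk ι)) (BlockNorm.ofBlocks g (liftBlk (blk ∘ π) ι))
      (idef (pull (liftMap π ι)) (pull (liftMap π ι)) (commOp (F' k) (fun p : X' × ι => hX' k p.1) ∘ₗ (projO none ∘ₗ bgPropV (stack (mulOp (fun p : X' × ι => χtX' k p.1) ∘ₗ N' k) (fun j => Sum.elim (fun μ => fgrad n' (liftEquiv (τ' μ) ι)) (fun μ => bgrad n' (liftEquiv (τ' μ) ι)) j ∘ₗ (mulOp (fun p : X' × ι => χtX' k p.1) ∘ₗ N' k))) (V' k))) (commOp (F k) (fun p : X × ι => hX k p.1) ∘ₗ (projO none ∘ₗ bgPropV (stack (mulOp (fun p : X × ι => χtX k p.1) ∘ₗ N k) (fun j => Sum.elim (fun μ => fgrad n (liftEquiv (τ μ) ι)) (fun μ => bgrad n (liftEquiv (τ μ) ι)) j ∘ₗ (mulOp (fun p : X × ι => χtX k p.1) ∘ₗ N k))) (V k))))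
      (fun y y' => ind (Sk k) y' * (rFK * Real.exp (-(ρ₃ * g.dist y y')))))
    (hDFX : ∀ k, HasMaj (BlockNorm.ofBlocks g (liftBlk blk ι)) (BlockNorm.ofBlocks g (liftBlk (blk ∘ π) ι))
      (idef (pull (liftMap π ι)) (pull (liftMap π ι)) (mulOp (fun p : X' × ι => hX' k p.1) ∘ₗ F' k ∘ₗ (projO none ∘ₗ bgPropV (stack (mulOp (fun p : X' × ι => χtX' k p.1) ∘ₗ N' k) (fun j => Sum.elim (fun μ => fgrad n' (liftEquiv (τ' μ) ι)) (fun μ => bgrad n' (liftEquiv (τ' μ) ι)) j ∘ₗ (mulOp (fun p : X' × ι => χtX' k p.1) ∘ₗ N' k))) (V' k))) (mulOp (fun p : X × ι => hX k p.1) ∘ₗ F k ∘ₗ (projO none ∘ₗ bgPropV (stack (mulOp (fun p : X × ι => χtX k p.1) ∘ₗ N k) (fun j => Sum.elim (fun μ => fgrad n (liftEquiv (τ μ) ι)) (fun μ => bgrad n (liftEquiv (τ μ) ι)) j ∘ₗ (mulOp (fun p : X × ι => χtX k p.1) ∘ₗ N k))) (V k))))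
      (fun y y' => ind (Sk k) y * (rFE * Real.exp (-(ρ₃ * g.dist y y')))))
    (hq' : Nov * ((Fintype.card ι : ℝ) ^ 2 * ((((Fintype.card J : ℝ) * (c₂ * ((β + (β₁ + ct * β)) * (1 - (β + (β₁ + ct * β)) * (R * cr) * cr)⁻¹) + 2 * (c₁ * ((β + (β₁ + ct * β)) * (1 - (β + (β₁ + ct * β)) * (R * cr) * cr)⁻¹))) + θW + cN * ((β + (β₁ + ct * β)) * (1 - (β + (β₁ + ct * β)) * (R * cr) * cr)⁻¹) * cr)
          + ((ℓ * (Real.exp 1 * ε)⁻¹ + 2 * (ω + ℓ * d₁)) * R * ((β + (β₁ + ct * β)) * (1 - (β + (β₁ + ct * β)) * (R * cr) * cr)⁻¹) * cr + R * c₁ * ((β + (β₁ + ct * β)) * (1 - (β + (β₁ + ct * β)) * (R * cr) * cr)⁻¹) * cr)) + θF) + (Fintype.card ι : ℝ) ^ 2 * ((ε₀ * (1 - (β + (β₁ + ct * β)) * (R * cr) * cr)⁻¹) + εF)) * cr < 1) :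
    HasMaj (BlockNorm.ofBlocks g (liftBlk blk ι)) (BlockNorm.ofBlocks g (liftBlk (blk ∘ π) ι))
      (idef (pull (liftMap π ι)) (pull (liftMap π ι))
        (glueInv (parametrix (fun k (p : X' × ι) => hX' k p.1) (fun k => mmulOp (fun x' => (ug' k x')ᵀ) ∘ₗ (projO none ∘ₗ bgPropV (stack (mulOp (fun p : X' × ι => χtX' k p.1) ∘ₗ N' k) (fun j => Sum.elim (fun μ => fgrad n' (liftEquiv (τ' μ) ι)) (fun μ => bgrad n' (liftEquiv (τ' μ) ι)) j ∘ₗ (mulOp (fun p : X' × ι => χtX' k p.1) ∘ₗ N' k))) (V' k)) ∘ₗ mmulOp (ug' k)))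
          (remainder Δ' (fun k (p : X' × ι) => hX' k p.1) (fun k => mmulOp (fun x' => (ug' k x')ᵀ) ∘ₗ (projO none ∘ₗ bgPropV (stack (mulOp (fun p : X' × ι => χtX' k p.1) ∘ₗ N' k) (fun j => Sum.elim (fun μ => fgrad n' (liftEquiv (τ' μ) ι)) (fun μ => bgrad n' (liftEquiv (τ' μ) ι)) j ∘ₗ (mulOp (fun p : X' × ι => χtX' k p.1) ∘ₗ N' k))) (V' k)) ∘ₗ mmulOp (ug' k)) -
            ∑ k, (mmulOp (fun x' => (ug' k x')ᵀ) ∘ₗ ((((-(mulOp (fun p : X' × ι => hX' k p.1) ∘ₗ NL' ∘ₗ mulOp (1 - fun p : X' × ι => χtX' k p.1))) ∘ₗ N' k) ∘ₗ (LinearMap.id + (V' k ∘ₗ stack LinearMap.id (fun j => Sum.elim (fun μ => fgrad n' (liftEquiv (τ' μ) ι)) (fun μ => bgrad n' (liftEquiv (τ' μ) ι)) j)) ∘ₗ (projO none ∘ₗ bgPropV (stack (mulOp (fun p : X' × ι => χtX' k p.1) ∘ₗ N' k) (fun j => Sum.elim (fun μ => fgrad n' (liftEquiv (τ' μ) ι))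 (fun μ => bgrad n' (liftEquiv (τ' μ) ι)) j ∘ₗ (mulOp (fun p : X' × ι => χtX' k p.1) ∘ₗ N' k))) (V' k))) + mulOp (fun p : X' × ι => hX' k p.1) ∘ₗ F' k ∘ₗ (projO none ∘ₗ bgPropV (stack (mulOp (fun p : X' × ι => χtX' k p.1) ∘ₗ N' k) (fun j => Sum.elim (fun μ => fgrad n' (liftEquiv (τ' μ) ι)) (fun μ => bgrad n' (liftEquiv (τ' μ) ι)) j ∘ₗ (mulOp (fun p : X' × ι => χtX' k p.1) ∘ₗ N' k))) (V' k)))) ∘ₗ mmulOp (ug' k)) ∘ₗ mulOp (fun p : X' × ι => hX' k p.1)))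
        (glueInv (parametrix (fun k (p : X × ι) => hX k p.1) (fun k => mmulOp (fun x => (ug k x)ᵀ) ∘ₗ (projO none ∘ₗ bgPropV (stack (mulOp (fun p : X × ι => χtX k p.1) ∘ₗ N k) (fun j => Sum.elim (fun μ => fgrad n (liftEquiv (τ μ) ι)) (fun μ => bgrad n (liftEquiv (τ μ) ι)) j ∘ₗ (mulOp (fun p : X × ι => χtX k p.1) ∘ₗ N k))) (V k)) ∘ₗ mmulOp (ug k)))
          (remainder Δ (fun k (p : X × ι) => hX k p.1) (fun k => mmulOp (fun x => (ug k x)ᵀ) ∘ₗ (projO none ∘ₗ bgPropV (stack (mulOp (fun p : X × ι => χtX k p.1) ∘ₗ N k) (fun j => Sum.elim (fun μ => fgrad n (liftEquiv (τ μ) ι)) (fun μ => bgrad n (liftEquiv (τ μ) ι)) j ∘ₗ (mulOp (fun p : X × ι => χtX k p.1) ∘ₗ N k))) (V k)) ∘ₗ mmulOp (ug k)) -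
            ∑ k, (mmulOp (fun x => (ug k x)ᵀ) ∘ₗ ((((-(mulOp (fun p : X × ι => hX k p.1) ∘ₗ NL ∘ₗ mulOp (1 - fun p : X × ι => χtX k p.1))) ∘ₗ N k) ∘ₗ (LinearMap.id + (V k ∘ₗ stack LinearMap.id (fun j => Sum.elim (fun μ => fgrad n (liftEquiv (τ μ) ι)) (fun μ => bgrad n (liftEquiv (τ μ) ι)) j)) ∘ₗ (projO none ∘ₗ bgPropV (stack (mulOp (fun p : X × ι => χtX k p.1) ∘ₗ N k) (fun j => Sum.elim (fun μ => fgrad n (liftEquiv (τ μ) ι)) (fun μ => bgrad n (liftEquiv (τ μ) ι)) j ∘ₗ (mulOp (fun p : X × ι => χtX k p.1) ∘ₗ N k))) (V k))) + mulOp (fun p : X × ι => hX k p.1) ∘ₗ F k ∘ₗ (projO none ∘ₗ bgPropV (stack (mulOp (fun p : X × ι => χtX k p.1) ∘ₗ N k) (fun j => Sum.elim (fun μ => fgrad n (liftEquiv (τ μ) ι)) (fun μ => bgrad n (liftEquiv (τ μ) ι)) j ∘ₗ (mulOp (fun p : X × ι => χtX k p.1) ∘ₗ N k))) (V k)))) ∘ₗ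 mmulOp (ug k)) ∘ₗ mulOp (fun p : X × ι => hX k p.1))))
      (fun y y' => (Nov * ((Fintype.card ι : ℝ) ^ 2 * ((β + (β₁ + ct * β)) * (1 - (β + (β₁ + ct * β)) * (R * cr) * cr)⁻¹)) * ((1 - Nov * ((Fintype.card ι : ℝ) ^ 2 * ((((Fintype.card J : ℝ) * (c₂ * ((β + (β₁ + ct * β)) * (1 - (β + (β₁ + ct * β)) * (R * cr) * cr)⁻¹) + 2 * (c₁ * ((β + (β₁ + ct * β)) * (1 - (β + (β₁ + ct * β)) * (R * cr) * cr)⁻¹))) + θW + cN * ((β + (β₁ + ct * β)) * (1 - (β + (β₁ + ct * β)) * (R * cr) * cr)⁻¹) * cr)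
          + ((ℓ * (Real.exp 1 * ε)⁻¹ + 2 * (ω + ℓ * d₁)) * R * ((β + (β₁ + ct * β)) * (1 - (β + (β₁ + ct * β)) * (R * cr) * cr)⁻¹) * cr + R * c₁ * ((β + (β₁ + ct * β)) * (1 - (β + (β₁ + ct * β)) * (R * cr) * cr)⁻¹) * cr)) + θF) + (Fintype.card ι : ℝ) ^ 2 * ((ε₀ * (1 - (β + (β₁ + ct * β)) * (R * cr) * cr)⁻¹) + εF)) * cr)⁻¹ *
          ((1 - Nov * ((Fintype.card ι : ℝ) ^ 2 * ((((Fintype.card J : ℝ) * (c₂ * ((β + (β₁ + ct * β)) * (1 - (β + (β₁ + ct * β)) * (R * cr) * cr)⁻¹) + 2 * (c₁ * ((β + (β₁ + ct * β)) * (1 - (β + (β₁ + ct * β)) * (R * cr) * cr)⁻¹))) + θW + cN * ((β + (β₁ + ct * β)) * (1 - (β + (β₁ + ct * β)) * (R * cr) * cr)⁻¹) * cr)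
          + ((ℓ * (Real.exp 1 * ε)⁻¹ + 2 * (ω + ℓ * d₁)) * R * ((β + (β₁ + ct * β)) * (1 - (β + (β₁ + ct * β)) * (R * cr) * cr)⁻¹) * cr + R * c₁ * ((β + (β₁ + ct * β)) * (1 - (β + (β₁ + ct * β)) * (R * cr) * cr)⁻¹) * cr)) + θF) + (Fintype.card ι : ℝ) ^ 2 * ((ε₀ * (1 - (β + (β₁ + ct * β)) * (R * cr) * cr)⁻¹) + εF)) * cr)⁻¹ *
            (Nov * ((Fintype.card ι : ℝ) ^ 2 * ((((Fintype.card J : ℝ) * (c₂ * ((β + (β₁ + ct * β)) * (1 - (β + (β₁ + ct * β)) * (R * cr) * cr)⁻¹) + 2 * (c₁ * ((β + (β₁ + ct * β)) * (1 - (β + (β₁ + ct * β)) * (R * cr) * cr)⁻¹))) + θW + cN * ((β + (β₁ + ct * β)) * (1 - (β + (β₁ + ct * β)) * (R * cr) * cr)⁻¹) * cr)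
          + ((ℓ * (Real.exp 1 * ε)⁻¹ + 2 * (ω + ℓ * d₁)) * R * ((β + (β₁ + ct * β)) * (1 - (β + (β₁ + ct * β)) * (R * cr) * cr)⁻¹) * cr + R * c₁ * ((β + (β₁ + ct * β)) * (1 - (β + (β₁ + ct * β)) * (R * cr) * cr)⁻¹) * cr)) + θF) * oo + ((Fintype.card ι : ℝ) ^ 2 * ((((Fintype.card J * (c₂ * ((((m₀ + oχ * β) + (m₁ + oχ₁ * β₁ + ct * m₀ + oχ₂ * β)) * cr + 1 * (((m₀ + oχ * β) + (m₁ + oχ₁ * β₁ + ct * m₀ + oχ₂ * β)) * cr) * (R * ((β + (β₁ + ct * β)) * (1 - (β + (β₁ + ct * β)) * (R * cr) * cr)⁻¹) * cr) + (β + (β₁ + ct * β)) * o * cr * ((β + (β₁ + ct * β)) * (1 - (β + (β₁ + ct * β)) * (R * cr) * cr)⁻¹) * cr) * (1 - 1 * ((β + (β₁ + ct * β)) * (R * cr) * cr))⁻¹)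
              + o₂ * ((β + (β₁ + ct * β)) * (1 - (β + (β₁ + ct * β)) * (R * cr) * cr)⁻¹)
              + 2 * (c₁ * ((((m₀ + oχ * β) + (m₁ + oχ₁ * β₁ + ct * m₀ + oχ₂ * β)) * cr + 1 * (((m₀ + oχ * β) + (m₁ + oχ₁ * β₁ + ct * m₀ + oχ₂ * β)) * cr) * (R * ((β + (β₁ + ct * β)) * (1 - (β + (β₁ + ct * β)) * (R * cr) * cr)⁻¹) * cr) + (β + (β₁ + ct * β)) * o * cr * ((β + (β₁ + ct * β)) * (1 - (β + (β₁ + ct * β)) * (R * cr) * cr)⁻¹) * cr) * (1 - 1 * ((β + (β₁ + ct * β)) * (R * cr) * cr))⁻¹)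
                + o₁ * ((β + (β₁ + ct * β)) * (1 - (β + (β₁ + ct * β)) * (R * cr) * cr)⁻¹))) + rW)
          + (cN * ((((m₀ + oχ * β) + (m₁ + oχ₁ * β₁ + ct * m₀ + oχ₂ * β)) * cr + 1 * (((m₀ + oχ * β) + (m₁ + oχ₁ * β₁ + ct * m₀ + oχ₂ * β)) * cr) * (R * ((β + (β₁ + ct * β)) * (1 - (β + (β₁ + ct * β)) * (R * cr) * cr)⁻¹) * cr) + (β + (β₁ + ct * β)) * o * cr * ((β + (β₁ + ct * β)) * (1 - (β + (β₁ + ct * β)) * (R * cr) * cr)⁻¹) * cr) * (1 - 1 * ((β + (β₁ + ct * β)) * (R * cr) * cr))⁻¹) * cr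
              + rN * ((β + (β₁ + ct * β)) * (1 - (β + (β₁ + ct * β)) * (R * cr) * cr)⁻¹) * cr)
          + ((((ℓ * (Real.exp 1 * ε)⁻¹ + 2 * (ω + ℓ * d₁)) * R)
                * ((((m₀ + oχ * β) + (m₁ + oχ₁ * β₁ + ct * m₀ + oχ₂ * β)) * cr + 1 * (((m₀ + oχ * β) + (m₁ + oχ₁ * β₁ + ct * m₀ + oχ₂ * β)) * cr) * (R * ((β + (β₁ + ct * β)) * (1 - (β + (β₁ + ct * β)) * (R * cr) * cr)⁻¹) * cr) + (β + (β₁ + ct * β)) * o * cr * ((β + (β₁ + ct * β)) * (1 - (β + (β₁ + ct * β)) * (R * cr) * cr)⁻¹) * cr) * (1 - 1 * ((β + (β₁ + ct * β)) * (R * cr) * cr))⁻¹)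
              + ((ℓ * (Real.exp 1 * ε)⁻¹ + 2 * (ω + ℓ * d₁)) * o + 2 * R * (oo + c₁ / n' + c₁ / n))
                * ((β + (β₁ + ct * β)) * (1 - (β + (β₁ + ct * β)) * (R * cr) * cr)⁻¹)
              + R * (c₁ * ((((m₀ + oχ * β) + (m₁ + oχ₁ * β₁ + ct * m₀ + oχ₂ * β)) * cr + 1 * (((m₀ + oχ * β) + (m₁ + oχ₁ * β₁ + ct * m₀ + oχ₂ * β)) * cr) * (R * ((β + (β₁ + ct * β)) * (1 - (β + (β₁ + ct * β)) * (R * cr) * cr)⁻¹) * cr) + (β + (β₁ + ct * β)) * o * cr * ((β + (β₁ + ct * β)) * (1 - (β + (β₁ + ct * β)) * (R * cr) * cr)⁻¹) * cr) * (1 - 1 * ((β + (β₁ + ct * β)) * (R * cr) * cr))⁻¹)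
                + o₁ * ((β + (β₁ + ct * β)) * (1 - (β + (β₁ + ct * β)) * (R * cr) * cr)⁻¹))
              + o * c₁ * ((β + (β₁ + ct * β)) * (1 - (β + (β₁ + ct * β)) * (R * cr) * cr)⁻¹)) * cr))) + rFK) + 2 * (Fintype.card ι : ℝ) * oW * ((((Fintype.card J : ℝ) * (c₂ * ((β + (β₁ + ct * β)) * (1 - (β + (β₁ + ct * β)) * (R * cr) * cr)⁻¹) + 2 * (c₁ * ((β + (β₁ + ct * β)) * (1 - (β + (β₁ + ct * β)) * (R * cr) * cr)⁻¹))) + θW + cN * ((β + (β₁ + ct * β)) * (1 - (β + (β₁ + ct * β)) * (R * cr) * cr)⁻¹) * cr)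
          + ((ℓ * (Real.exp 1 * ε)⁻¹ + 2 * (ω + ℓ * d₁)) * R * ((β + (β₁ + ct * β)) * (1 - (β + (β₁ + ct * β)) * (R * cr) * cr)⁻¹) * cr + R * c₁ * ((β + (β₁ + ct * β)) * (1 - (β + (β₁ + ct * β)) * (R * cr) * cr)⁻¹) * cr)) + θF)) +
              ((Fintype.card ι : ℝ) ^ 2 * ((ε₀ * (1 - (β + (β₁ + ct * β)) * (R * cr) * cr)⁻¹) + εF) * oo + ((Fintype.card ι : ℝ) ^ 2 * ((ε₀ * (R * ((((m₀ + oχ * β) + (m₁ + oχ₁ * β₁ + ct * m₀ + oχ₂ * β)) * cr + 1 * (((m₀ + oχ * β) + (m₁ + oχ₁ * β₁ + ct * m₀ + oχ₂ * β)) * cr) * (R * ((β + (β₁ + ct * β)) * (1 - (β + (β₁ + ct * β)) * (R * cr) * cr)⁻¹) * cr) + (β + (β₁ + ct * β)) * o * cr * ((β + (β₁ + ct * β)) * (1 - (β + (β₁ + ct * β)) * (R * cr) * cr)⁻¹) * cr) * (1 - 1 * ((β + (β₁ + ct * β)) * (R * cr) * cr))⁻¹) + o * ((β + (β₁ + ct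 * β)) * (1 - (β + (β₁ + ct * β)) * (R * cr) * cr)⁻¹)) * cr * cr + rF * (1 + R * ((β + (β₁ + ct * β)) * (1 - (β + (β₁ + ct * β)) * (R * cr) * cr)⁻¹) * cr * cr)) + rFE) + 2 * (Fintype.card ι : ℝ) * oW * ((ε₀ * (1 - (β + (β₁ + ct * β)) * (R * cr) * cr)⁻¹) + εF))))) * cr) * cr) * cr +
        Nov * (2 * ((Fintype.card ι : ℝ) ^ 2 * ((β + (β₁ + ct * β)) * (1 - (β + (β₁ + ct * β)) * (R * cr) * cr)⁻¹)) * oo + ((Fintype.card ι : ℝ) ^ 2 * ((((m₀ + oχ * β) + (m₁ + oχ₁ * β₁ + ct * m₀ + oχ₂ * β)) * cr + 1 * (((m₀ + oχ * β) + (m₁ + oχ₁ * β₁ + ct * m₀ + oχ₂ * β)) * cr) * (R * ((β + (β₁ + ct * β)) * (1 - (β + (β₁ + ct * β)) * (R * cr) * cr)⁻¹) * cr) + (β + (β₁ + ct * β)) * o * cr * ((β + (β₁ + ct * β)) * (1 - (β + (β₁ + ct * β)) * (R * cr) * cr)⁻¹) * cr) * (1 - 1 * ((β + (β₁ + ct *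 β)) * (R * cr) * cr))⁻¹) + 2 * (Fintype.card ι : ℝ) * oW * ((β + (β₁ + ct * β)) * (1 - (β + (β₁ + ct * β)) * (R * cr) * cr)⁻¹))) *
          (1 - Nov * ((Fintype.card ι : ℝ) ^ 2 * ((((Fintype.card J : ℝ) * (c₂ * ((β + (β₁ + ct * β)) * (1 - (β + (β₁ + ct * β)) * (R * cr) * cr)⁻¹) + 2 * (c₁ * ((β + (β₁ + ct * β)) * (1 - (β + (β₁ + ct * β)) * (R * cr) * cr)⁻¹))) + θW + cN * ((β + (β₁ + ct * β)) * (1 - (β + (β₁ + ct * β)) * (R * cr) * cr)⁻¹) * cr)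
          + ((ℓ * (Real.exp 1 * ε)⁻¹ + 2 * (ω + ℓ * d₁)) * R * ((β + (β₁ + ct * β)) * (1 - (β + (β₁ + ct * β)) * (R * cr) * cr)⁻¹) * cr + R * c₁ * ((β + (β₁ + ct * β)) * (1 - (β + (β₁ + ct * β)) * (R * cr) * cr)⁻¹) * cr)) + θF) + (Fintype.card ι : ℝ) ^ 2 * ((ε₀ * (1 - (β + (β₁ + ct * β)) * (R * cr) * cr)⁻¹) + εF)) * cr)⁻¹ * cr) *
        Real.exp (-((ρ₃ - 2 * σ) * g.dist y y'))) := by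
  obtain ⟨hβb, hmb, hB, hAD, hθ, hε', hrE⟩ := gluedDefect_letters_nonneg (J := J) hβ hβ₁ hct hm₀ hm₁ hoχ hoχ₁ hoχ₂ hR ho hε hc₁ hc₂ hθW hcN hℓ hω hd₁ hε₀ hrF hcr hq
  have hr : 0 ≤ (((Fintype.card J * (c₂ * ((((m₀ + oχ * β) + (m₁ + oχ₁ * β₁ + ct * m₀ + oχ₂ * β)) * cr + 1 * (((m₀ + oχ * β) + (m₁ + oχ₁ * β₁ + ct * m₀ + oχ₂ * β)) * cr) * (R * ((β + (β₁ + ct * β)) * (1 - (β + (β₁ + ct * β)) * (R * cr) * cr)⁻¹) * cr) + (β + (β₁ + ct * β)) * o * cr * ((β + (β₁ + ct * β)) * (1 - (β + (β₁ + ct * β)) * (R * cr) * cr)⁻¹) * cr) * (1 - 1 * ((β + (β₁ + ct * β)) * (R * cr) * cr))⁻¹)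
              + o₂ * ((β + (β₁ + ct * β)) * (1 - (β + (β₁ + ct * β)) * (R * cr) * cr)⁻¹)
              + 2 * (c₁ * ((((m₀ + oχ * β) + (m₁ + oχ₁ * β₁ + ct * m₀ + oχ₂ * β)) * cr + 1 * (((m₀ + oχ * β) + (m₁ + oχ₁ * β₁ + ct * m₀ + oχ₂ * β)) * cr) * (R * ((β + (β₁ + ct * β)) * (1 - (β + (β₁ + ct * β)) * (R * cr) * cr)⁻¹) * cr) + (β + (β₁ + ct * β)) * o * cr * ((β + (β₁ + ct * β)) * (1 - (β + (β₁ + ct * β)) * (R * cr) * cr)⁻¹) * cr) * (1 - 1 * ((β + (β₁ + ct * β)) * (R * cr) * cr))⁻¹)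
                + o₁ * ((β + (β₁ + ct * β)) * (1 - (β + (β₁ + ct * β)) * (R * cr) * cr)⁻¹))) + rW)
          + (cN * ((((m₀ + oχ * β) + (m₁ + oχ₁ * β₁ + ct * m₀ + oχ₂ * β)) * cr + 1 * (((m₀ + oχ * β) + (m₁ + oχ₁ * β₁ + ct * m₀ + oχ₂ * β)) * cr) * (R * ((β + (β₁ + ct * β)) * (1 - (β + (β₁ + ct * β)) * (R * cr) * cr)⁻¹) * cr) + (β + (β₁ + ct * β)) * o * cr * ((β + (β₁ + ct * β)) * (1 - (β + (β₁ + ct * β)) * (R * cr) * cr)⁻¹) * cr) * (1 - 1 * ((β + (β₁ + ct * β)) * (R * cr) * cr))⁻¹) * cr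
              + rN * ((β + (β₁ + ct * β)) * (1 - (β + (β₁ + ct * β)) * (R * cr) * cr)⁻¹) * cr)
          + ((((ℓ * (Real.exp 1 * ε)⁻¹ + 2 * (ω + ℓ * d₁)) * R)
                * ((((m₀ + oχ * β) + (m₁ + oχ₁ * β₁ + ct * m₀ + oχ₂ * β)) * cr + 1 * (((m₀ + oχ * β) + (m₁ + oχ₁ * β₁ + ct * m₀ + oχ₂ * β)) * cr) * (R * ((β + (β₁ + ct * β)) * (1 - (β + (β₁ + ct * β)) * (R * cr) * cr)⁻¹) * cr) + (β + (β₁ + ct * β)) * o * cr * ((β + (β₁ + ct * β)) * (1 - (β + (β₁ + ct * β)) * (R * cr) * cr)⁻¹) * cr) * (1 - 1 * ((β + (β₁ + ct * β)) * (R * cr) * cr))⁻¹)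
              + ((ℓ * (Real.exp 1 * ε)⁻¹ + 2 * (ω + ℓ * d₁)) * o + 2 * R * (oo + c₁ / n' + c₁ / n))
                * ((β + (β₁ + ct * β)) * (1 - (β + (β₁ + ct * β)) * (R * cr) * cr)⁻¹)
              + R * (c₁ * ((((m₀ + oχ * β) + (m₁ + oχ₁ * β₁ + ct * m₀ + oχ₂ * β)) * cr + 1 * (((m₀ + oχ * β) + (m₁ + oχ₁ * β₁ + ct * m₀ + oχ₂ * β)) * cr) * (R * ((β + (β₁ + ct * β)) * (1 - (β + (β₁ + ct * β)) * (R * cr) * cr)⁻¹) * cr) + (β + (β₁ + ct * β)) * o * cr * ((β + (β₁ + ct * β)) * (1 - (β + (β₁ + ct * β)) * (R * cr) * cr)⁻¹) * cr) * (1 - 1 * ((β + (β₁ + ct * β)) * (R * cr) * cr))⁻¹)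
                + o₁ * ((β + (β₁ + ct * β)) * (1 - (β + (β₁ + ct * β)) * (R * cr) * cr)⁻¹))
              + o * c₁ * ((β + (β₁ + ct * β)) * (1 - (β + (β₁ + ct * β)) * (R * cr) * cr)⁻¹)) * cr))) :=
    add_nonneg (add_nonneg (gluedDefect_r0a_nonneg (J := J) hβ hβ₁ hct hm₀ hm₁ hoχ hoχ₁ hoχ₂ hR ho hc₁ hc₂ ho₁ ho₂ hrW hcr hq)
      (gluedDefect_r0b_nonneg hβ hβ₁ hct hm₀ hm₁ hoχ hoχ₁ hoχ₂ hR ho hcN hrN hcr hq))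
      (gluedDefect_r0c_nonneg n n' hβ hβ₁ hct hm₀ hm₁ hoχ hoχ₁ hoχ₂ hR ho hε hc₁ ho₁ hℓ hω hd₁ hoo hcr hn hn' hq)
  have hσρ₂ : σ ≤ ρ₂ := by linarith only [hσ, hσρ₃, hρ₃₂]
  have hρ₂V : ρ₂ + σ ≤ δV := by linarith only [hρ₂₁, hρ₁V]
  -- files 31∕34∕35: flat letters of both grids' smooth-cut cubes and jets, their defects; file 23: summable Neumann series and the pair letters; file 24: the pair defect
  have hG := fun k => hasMaj_smoothCut_flat blk (S := Sk k) hβ hβ₁ hct (hχt k) (hsub k) (hcut k)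
  have hD := fun k => hasMaj_jet_smoothCut_flat blk τ n (S := Sk k) hβ hβ₁ hct (hχt k) (hdχt k) (hdχtb k) (hs k) (hsb k) (hdd k) (hddb k) (hcut k) (hcutF k) (hcutB k)
  have hG' := fun k => hasMaj_smoothCut_flat (blk ∘ π) (S := Sk k) hβ hβ₁ hct (hχt' k) (hsub' k) (hcut' k)
  have hD' := fun k => hasMaj_jet_smoothCut_flat (blk ∘ π) τ' n' (S := Sk k) hβ hβ₁ hct (hχt' k) (hdχt' k) (hdχtb' k) (hs' k) (hsb' k) (hdd' k) (hddb' k) (hcut' k) (hcutF' k)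
    (hcutB' k)
  have hDG := fun k => hasMaj_idef_smoothCut_flat blk π (S := Sk k) (N := N k) (N' := N' k) hβ hβ₁ hct hm₀ hm₁ hoχ hoχ₁ hoχ₂ (hχt' k) (hfitχ k) (hsub k) (hsub' k) (hcut k) (hDcut k)
  have hDD := fun k => hasMaj_idef_jet_smoothCut_flat blk π τ τ' n n' (S := Sk k) (N := N k) (N' := N' k) hβ hβ₁ hct hm₀ hm₁ hoχ hoχ₁ hoχ₂ (hχt' k) (hdχt' k) (hdχtb' k) (hfit₁ k)
    (hfit₁b k) (hfit₂ k) (hfit₂b k) (hs k) (hsb k) (hdd k) (hddb k) (hs' k) (hsb' k) (hdd' k) (hddb' k) (hcut k) (hcutF k) (hcutB k) (hDcut k) (hDcutF k) (hDcutB k)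
  have hpair := fun k => hasMaj_dressedV_pair blk htri hd hrow hσ hβb hR hcr hσρ hρ₁V hρ₁G hρ₂ hρ₂₁ (hG k) (hD k) (hV k) hq
  have hpair' := fun k => hasMaj_dressedV_pair (blk ∘ π) htri hd hrow hσ hβb hR hcr hσρ hρ₁V hρ₁G hρ₂ hρ₂₁ (hG' k) (hD' k) (hV' k) hq
  have hDX := fun k => hasMaj_idef_dressedV_pair blk π htri hd hrow hσ hcr hβb hR ho hmb hσρ hρ₁V hρ₁G hρ₂ hρ₂₁ (hG k) (hD k) (hG' k) (hD' k) (hDG k) (hDD k) (hV k) (hV' k) (hDV k) hq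
  -- file 34: both grids' cut letters (`M_χX = X`), at the rate `ρ₃`
  have hGc := fun k => by
    have h34 := (hasMaj_smoothCutDressed_loc₂ blk τ n htri hd hrow hσ hβ hβ₁ hct hR hcr hσρ hρ₁V hρ₁G hρ₂ hρ₂₁ (hSχ k) (hSψ k) (hχt k) (hdχt k) (hdχtb k) (hsub k) (hχ k) (hs k) (hsb k) (hdd k) (hddb k) (hNψ k) (hcut k) (hcutF k) (hcutB k) (hV k) hq).mono fun y y' =>
      weight_mul_exp_rate_mono (mul_nonneg (ind_nonneg _ _) (ind_nonneg _ _)) hB hρ₃₂ (hd y y')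
    rw [← mulOp_comp_smoothCutDressed τ n (hχ k) (hNψ k) (hpair k).1] at h34
    exact h34
  have hGc' := fun k => by
    have h34 := (hasMaj_smoothCutDressed_loc₂ (blk ∘ π) τ' n' htri hd hrow hσ hβ hβ₁ hct hR hcr hσρ hρ₁V hρ₁G hρ₂ hρ₂₁ (hSχ' k) (hSψ' k) (hχt' k) (hdχt' k) (hdχtb' k) (hsub' k) (hχ' k) (hs' k) (hsb' k) (hdd' k) (hddb' k) (hNψ' k) (hcut' k) (hcutF' k) (hcutB' k) (hV' k) hq).mono fun y y' =>
      weight_mul_exp_rate_mono (mul_nonneg (ind_nonneg _ _) (ind_nonneg _ _)) hB hρ₃₂ (hd y y')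
    rw [← mulOp_comp_smoothCutDressed τ' n' (hχ' k) (hNψ' k) (hpair' k).1] at h34
    exact h34
  -- file 38: both grids' input-localized remainder rows (rate `ρ₃`)
  have hK := fun k => hasMaj_commOp_cubeOp_smoothCutDressed_in blk τ n htri hd hsymm hrow hσ hβ hβ₁ hct hR hcr hσρ hρ₁V hρ₁G hρ₂ hρ₂₁ hρ₃ hρ₃₂ hρ₃V hρ₃N hε hc₁ hc₂ hθW hcN hℓ hω hd₁ (hSχ k) (hSψ k) (hχt k) (hdχt k) (hdχtb k) (hsub k) (hχ k) (hs k) (hsb k) (hdd k) (hddb k) (hs2 k) (hsb2 k) (hdd2 k) (hddb2 k) (hNψ k) (hcut k) (hcutF k) (hcutB k) (hV k) hq (hh1 k) (hh1b k) (hh2 k) (hLip k) (hrh k) hstep (hW k) (hKN k)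
  have hK' := fun k => hasMaj_commOp_cubeOp_smoothCutDressed_in (blk ∘ π) τ' n' htri hd hsymm hrow hσ hβ hβ₁ hct hR hcr hσρ hρ₁V hρ₁G hρ₂ hρ₂₁ hρ₃ hρ₃₂ hρ₃V hρ₃N hε hc₁ hc₂ hθW hcN hℓ hω hd₁ (hSχ' k) (hSψ' k) (hχt' k) (hdχt' k) (hdχtb' k) (hsub' k) (hχ' k) (hs' k) (hsb' k) (hdd' k) (hddb' k) (hs2' k) (hsb2' k) (hdd2' k) (hddb2' k) (hNψ' k) (hcut' k) (hcutF' k) (hcutB' k) (hV' k) hq (hh1' k) (hh1b' k) (hh2' k) (hLip k) (hrh' k) hstep' (hW' k) (hKN' k)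
  -- file 33: both grids' locality defects' letters (rate `ρ₃`)
  have hE := fun k => (hasMaj_dressedTail_out blk htri hd hrow hσ hβb hR hε₀ hcr hσρ hρ₁V hρ₁G hρ₂ hρ₂₁ hρ₂T (fun _ => rfl) (hG k) (hD k) (hV k) hq (hT k)).mono
    fun y y' => weight_mul_exp_rate_mono (ind_nonneg _ _) hε' hρ₃₂ (hd y y')
  have hE' := fun k => (hasMaj_dressedTail_out (blk ∘ π) htri hd hrow hσ hβb hR hε₀ hcr hσρ hρ₁V hρ₁G hρ₂ hρ₂₁ hρ₂T (fun _ => rfl) (hG' k) (hD' k) (hV' k) hq (hT' k)).mono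
    fun y y' => weight_mul_exp_rate_mono (ind_nonneg _ _) hε' hρ₃₂ (hd y y')
  -- file 35: the two-grid defect of the cut letters (rate `ρ₃`)
  have hDGc := fun k => by
    have h35 := (hasMaj_idef_smoothCutDressed_loc₂ blk π τ τ' n n' htri hd hrow hσ hcr hβ hβ₁ hct hm₀ hm₁ hoχ hoχ₁ hoχ₂ hR ho hσρ hρ₁V hρ₁G hρ₂ hρ₂₁ (hSχ k) (hSψ k) (hSχ' k) (hSψ' k) (hχt k) (hdχt k) (hdχtb k) (hsub k) (hχ k) (hs k) (hsb k) (hdd k) (hddb k) (hNψ k) (hχt' k) (hdχt' k) (hdχtb' k) (hsub' k) (hχ' k) (hs' k) (hsb' k) (hdd' k) (hddb' k) (hNψ' k) (hfitχ k) (hfit₁ k) (hfit₁b k) (hfit₂ k) (hfit₂b k) (hcut k) (hcutF k) (hcutB k) (hcut' k) (hcutF' k) (hcutB' k) (hDcut k) (hDcutF k) (hDcutB k) (hV k) (hV' k) (hDV k) hq).mono fun y y' =>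
      weight_mul_exp_rate_mono (mul_nonneg (ind_nonneg _ _) (ind_nonneg _ _)) hAD hρ₃₂ (hd y y')
    rw [← mulOp_comp_smoothCutDressed τ n (hχ k) (hNψ k) (hpair k).1, ← mulOp_comp_smoothCutDressed τ' n' (hχ' k) (hNψ' k) (hpair' k).1] at h35
    exact h35
  -- file 39: the two-grid defect of the remainder rows (rate `ρ₃`)
  have hDK := fun k => hasMaj_idef_commOp_cubeOp_smoothCutDressed_in blk π τ τ' n n' htri hd hsymm hrow hσ hcr hβ hβ₁ hct hm₀ hm₁ hoχ hoχ₁ hoχ₂ hR ho hσρ hρ₁V hρ₁G hρ₂ hρ₂₁ hρ₃ hρ₃₂ hρ₃V hρ₃N hε hc₁ hc₂ ho₁ ho₂ hrW hcN hrN hℓ hω hd₁ hoo hn hn' (hSχ k) (hSψ k) (hSχ' k) (hSψ' k) (hχt k) (hdχt k) (hdχtb k) (hsub k) (hχ k) (hs k) (hsb k) (hdd k) (hddb k) (hNψ k) (hχt' k) (hdχt' k) (hdχtb' k) (hsub' k) (hχ' k) (hs' k) (hsb' k) (hdd' k) (hddb' k) (hNψ' k) (hfitχ k) (hfit₁ k)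 (hfit₁b k) (hfit₂ k) (hfit₂b k) (hcut k) (hcutF k) (hcutB k) (hcut' k) (hcutF' k) (hcutB' k) (hDcut k) (hDcutF k) (hDcutB k) (hs2 k) (hsb2 k) (hdd2 k) (hddb2 k) (hs2' k) (hsb2' k) (hdd2' k) (hddb2' k) (hV k) (hV' k) (hDV k) hq (hh1 k) (hh1b k) (hh1' k) (hh1b' k) (hh2' k) (hf1 k) (hf1b k) (hf2 k) (hLip k) (hrh k) (hrh' k) (hfh k) hstep hstep' (hDW k) (hKN' k) (hDKN k)
  -- file 33: the two-grid defect of the locality defects (rate `ρ₃`)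
  have hDE := fun k => (hasMaj_idef_dressedTail_out blk π htri hd hrow hσ hcr hR ho hε₀ hrF hB hAD hσρ₂ hρ₂V hρ₂T (fun _ => rfl) (fun _ => rfl) (hpair k).1 (hpair' k).1 (hT' k)
    (hDT k) (hpair k).2 (hDX k) (hV k) (hV' k) (hDV k)).mono fun y y' => weight_mul_exp_rate_mono (ind_nonneg _ _) hrE hρ₃₂ (hd y y')
  -- the far defects `F_k`, `F′_k` of the local-gauge operators: their rows join the remainder rows and the locality defects, their η-defects the defect rows
  have eC : ∀ (A B G : (X × ι → ℝ) →ₗ[ℝ] (X × ι → ℝ)) (a : X × ι → ℝ), commOp (A + B) a ∘ₗ G = commOp A a ∘ₗ G + commOp B a ∘ₗ G := fun A B G a => by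
    simp only [commOp, LinearMap.add_comp, LinearMap.comp_add, LinearMap.sub_comp]; abel
  have eC' : ∀ (A B G : (X' × ι → ℝ) →ₗ[ℝ] (X' × ι → ℝ)) (a : X' × ι → ℝ), commOp (A + B) a ∘ₗ G = commOp A a ∘ₗ G + commOp B a ∘ₗ G := fun A B G a => by
    simp only [commOp, LinearMap.add_comp, LinearMap.comp_add, LinearMap.sub_comp]; abel
  have hKt : ∀ k, HasMaj (BlockNorm.ofBlocks g (liftBlk blk ι)) (BlockNorm.ofBlocks g (liftBlk blk ι)) (commOp (mmulOp (ug k) ∘ₗ Δ ∘ₗ mmulOp (fun x => (ug k x)ᵀ)) (fun p : X × ι => hX k p.1) ∘ₗ (projO none ∘ₗ bgPropV (stack (mulOp (fun p : X × ι => χtX k p.1) ∘ₗ N k) (fun j => Sum.elim (fun μ => fgrad n (liftEquiv (τ μ) ι)) (fun μ => bgrad n (liftEquiv (τ μ) ι)) j ∘ₗ (mulOp (fun p : X × ι => χtX k p.1) ∘ₗ N k))) (V k)))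
      (fun y y' => ind (Sk k) y' * (((((Fintype.card J : ℝ) * (c₂ * ((β + (β₁ + ct * β)) * (1 - (β + (β₁ + ct * β)) * (R * cr) * cr)⁻¹) + 2 * (c₁ * ((β + (β₁ + ct * β)) * (1 - (β + (β₁ + ct * β)) * (R * cr) * cr)⁻¹))) + θW + cN * ((β + (β₁ + ct * β)) * (1 - (β + (β₁ + ct * β)) * (R * cr) * cr)⁻¹) * cr)
          + ((ℓ * (Real.exp 1 * ε)⁻¹ + 2 * (ω + ℓ * d₁)) * R * ((β + (β₁ + ct * β)) * (1 - (β + (β₁ + ct * β)) * (R * cr) * cr)⁻¹) * cr + R * c₁ * ((β + (β₁ + ct * β)) * (1 - (β + (β₁ + ct * β)) * (R * cr) * cr)⁻¹) * cr)) + θF) * Real.exp (-(ρ₃ * g.dist y y')))) := fun k => by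
    rw [hcov k, eC]
    exact ((hK k).add (hFK k)).mono fun y y' => le_of_eq (by ring)
  have hKt' : ∀ k, HasMaj (BlockNorm.ofBlocks g (liftBlk (blk ∘ π) ι)) (BlockNorm.ofBlocks g (liftBlk (blk ∘ π) ι)) (commOp (mmulOp (ug' k) ∘ₗ Δ' ∘ₗ mmulOp (fun x' => (ug' k x')ᵀ)) (fun p : X' × ι => hX' k p.1) ∘ₗ (projO none ∘ₗ bgPropV (stack (mulOp (fun p : X' × ι => χtX' k p.1) ∘ₗ N' k) (fun j => Sum.elim (fun μ => fgrad n' (liftEquiv (τ' μ) ι)) (fun μ => bgrad n' (liftEquiv (τ' μ) ι)) j ∘ₗ (mulOp (fun p : X' × ι => χtX' k p.1) ∘ₗ N' k))) (V' k)))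
      (fun y y' => ind (Sk k) y' * (((((Fintype.card J : ℝ) * (c₂ * ((β + (β₁ + ct * β)) * (1 - (β + (β₁ + ct * β)) * (R * cr) * cr)⁻¹) + 2 * (c₁ * ((β + (β₁ + ct * β)) * (1 - (β + (β₁ + ct * β)) * (R * cr) * cr)⁻¹))) + θW + cN * ((β + (β₁ + ct * β)) * (1 - (β + (β₁ + ct * β)) * (R * cr) * cr)⁻¹) * cr)
          + ((ℓ * (Real.exp 1 * ε)⁻¹ + 2 * (ω + ℓ * d₁)) * R * ((β + (β₁ + ct * β)) * (1 - (β + (β₁ + ct * β)) * (R * cr) * cr)⁻¹) * cr + R * c₁ * ((β + (β₁ + ct * β)) * (1 - (β + (β₁ + ct * β)) * (R * cr) * cr)⁻¹) * cr)) + θF) * Real.exp (-(ρ₃ * g.dist y y')))) := fun k => by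
    rw [hcov' k, eC']
    exact ((hK' k).add (hFK' k)).mono fun y y' => le_of_eq (by ring)
  have hEt : ∀ k, HasMaj (BlockNorm.ofBlocks g (liftBlk blk ι)) (BlockNorm.ofBlocks g (liftBlk blk ι)) (((-(mulOp (fun p : X × ι => hX k p.1) ∘ₗ NL ∘ₗ mulOp (1 - fun p : X × ι => χtX k p.1))) ∘ₗ N k) ∘ₗ (LinearMap.id + (V k ∘ₗ stack LinearMap.id (fun j => Sum.elim (fun μ => fgrad n (liftEquiv (τ μ) ι)) (fun μ => bgrad n (liftEquiv (τ μ) ι)) j)) ∘ₗ (projO none ∘ₗ bgPropV (stack (mulOp (fun p : X × ι => χtX k p.1) ∘ₗ N k) (fun j => Sum.elim (fun μ => fgrad n (liftEquiv (τ μ) ι)) (fun μ => bgrad n (liftEquiv (τ μ) ι)) j ∘ₗ (mulOp (fun p : X × ι => χtX k p.1) ∘ₗ N k))) (V k))) + mulOp (fun p : X × ι => hX k p.1) ∘ₗ F k ∘ₗ (projO none ∘ₗ bgPropV (stack (mulOp (fun p : X × ι => χtX k p.1) ∘ₗ N k) (fun j => Sum.elim (fun μ => fgrad n (liftEquiv (τ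 μ) ι)) (fun μ => bgrad n (liftEquiv (τ μ) ι)) j ∘ₗ (mulOp (fun p : X × ι => χtX k p.1) ∘ₗ N k))) (V k)))
      (fun y y' => ind (Sk k) y * (((ε₀ * (1 - (β + (β₁ + ct * β)) * (R * cr) * cr)⁻¹) + εF) * Real.exp (-(ρ₃ * g.dist y y')))) := fun k => ((hE k).add (hFX k)).mono fun y y' => le_of_eq (by ring)
  have hEt' : ∀ k, HasMaj (BlockNorm.ofBlocks g (liftBlk (blk ∘ π) ι)) (BlockNorm.ofBlocks g (liftBlk (blk ∘ π) ι)) (((-(mulOp (fun p : X' × ι => hX' k p.1) ∘ₗ NL' ∘ₗ mulOp (1 - fun p : X' × ι => χtX' k p.1))) ∘ₗ N' k) ∘ₗ (LinearMap.id + (V' k ∘ₗ stack LinearMap.id (fun j => Sum.elim (fun μ => fgrad n' (liftEquiv (τ' μ) ι)) (fun μ => bgrad n' (liftEquiv (τ' μ) ι)) j)) ∘ₗ (projO none ∘ₗ bgPropV (stack (mulOp (fun p : X' × ι => χtX' k p.1) ∘ₗ N' k) (fun j => Sum.elim (fun μ => fgrad n' (liftEquiv (τ' μ) ι)) (fun μ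 => bgrad n' (liftEquiv (τ' μ) ι)) j ∘ₗ (mulOp (fun p : X' × ι => χtX' k p.1) ∘ₗ N' k))) (V' k))) + mulOp (fun p : X' × ι => hX' k p.1) ∘ₗ F' k ∘ₗ (projO none ∘ₗ bgPropV (stack (mulOp (fun p : X' × ι => χtX' k p.1) ∘ₗ N' k) (fun j => Sum.elim (fun μ => fgrad n' (liftEquiv (τ' μ) ι)) (fun μ => bgrad n' (liftEquiv (τ' μ) ι)) j ∘ₗ (mulOp (fun p : X' × ι => χtX' k p.1) ∘ₗ N' k))) (V' k)))
      (fun y y' => ind (Sk k) y * (((ε₀ * (1 - (β + (β₁ + ct * β)) * (R * cr) * cr)⁻¹) + εF) * Real.exp (-(ρ₃ * g.dist y y')))) := fun k => ((hE' k).add (hFX' k)).mono fun y y' => le_of_eq (by ring)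
  have hDKt : ∀ k, HasMaj (BlockNorm.ofBlocks g (liftBlk blk ι)) (BlockNorm.ofBlocks g (liftBlk (blk ∘ π) ι))
      (idef (pull (liftMap π ι)) (pull (liftMap π ι)) (commOp (mmulOp (ug' k) ∘ₗ Δ' ∘ₗ mmulOp (fun x' => (ug' k x')ᵀ)) (fun p : X' × ι => hX' k p.1) ∘ₗ (projO none ∘ₗ bgPropV (stack (mulOp (fun p : X' × ι => χtX' k p.1) ∘ₗ N' k) (fun j => Sum.elim (fun μ => fgrad n' (liftEquiv (τ' μ) ι)) (fun μ => bgrad n' (liftEquiv (τ' μ) ι)) j ∘ₗ (mulOp (fun p : X' × ι => χtX' k p.1) ∘ₗ N' k))) (V' k)))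
        (commOp (mmulOp (ug k) ∘ₗ Δ ∘ₗ mmulOp (fun x => (ug k x)ᵀ)) (fun p : X × ι => hX k p.1) ∘ₗ (projO none ∘ₗ bgPropV (stack (mulOp (fun p : X × ι => χtX k p.1) ∘ₗ N k) (fun j => Sum.elim (fun μ => fgrad n (liftEquiv (τ μ) ι)) (fun μ => bgrad n (liftEquiv (τ μ) ι)) j ∘ₗ (mulOp (fun p : X × ι => χtX k p.1) ∘ₗ N k))) (V k))))
      (fun y y' => ind (Sk k) y' * ((((((Fintype.card J * (c₂ * ((((m₀ + oχ * β) + (m₁ + oχ₁ * β₁ + ct * m₀ + oχ₂ * β)) * cr + 1 * (((m₀ + oχ * β) + (m₁ + oχ₁ * β₁ + ct * m₀ + oχ₂ * β)) * cr) * (R * ((β + (β₁ + ct * β)) * (1 - (β + (β₁ + ct * β)) * (R * cr) * cr)⁻¹) * cr) + (β + (β₁ + ct * β)) * o * cr * ((β + (β₁ + ct * β)) * (1 - (β + (β₁ + ct * β)) * (R * cr) * cr)⁻¹) * cr) * (1 - 1 * ((β + (β₁ + ct * β)) * (R * cr) * cr))⁻¹)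
              + o₂ * ((β + (β₁ + ct * β)) * (1 - (β + (β₁ + ct * β)) * (R * cr) * cr)⁻¹)
              + 2 * (c₁ * ((((m₀ + oχ * β) + (m₁ + oχ₁ * β₁ + ct * m₀ + oχ₂ * β)) * cr + 1 * (((m₀ + oχ * β) + (m₁ + oχ₁ * β₁ + ct * m₀ + oχ₂ * β)) * cr) * (R * ((β + (β₁ + ct * β)) * (1 - (β + (β₁ + ct * β)) * (R * cr) * cr)⁻¹) * cr) + (β + (β₁ + ct * β)) * o * cr * ((β + (β₁ + ct * β)) * (1 - (β + (β₁ + ct * β)) * (R * cr) * cr)⁻¹) * cr) * (1 - 1 * ((β + (β₁ + ct * β)) * (R * cr) * cr))⁻¹)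
                + o₁ * ((β + (β₁ + ct * β)) * (1 - (β + (β₁ + ct * β)) * (R * cr) * cr)⁻¹))) + rW)
          + (cN * ((((m₀ + oχ * β) + (m₁ + oχ₁ * β₁ + ct * m₀ + oχ₂ * β)) * cr + 1 * (((m₀ + oχ * β) + (m₁ + oχ₁ * β₁ + ct * m₀ + oχ₂ * β)) * cr) * (R * ((β + (β₁ + ct * β)) * (1 - (β + (β₁ + ct * β)) * (R * cr) * cr)⁻¹) * cr) + (β + (β₁ + ct * β)) * o * cr * ((β + (β₁ + ct * β)) * (1 - (β + (β₁ + ct * β)) * (R * cr) * cr)⁻¹) * cr) * (1 - 1 * ((β + (β₁ + ct * β)) * (R * cr) * cr))⁻¹) * cr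
              + rN * ((β + (β₁ + ct * β)) * (1 - (β + (β₁ + ct * β)) * (R * cr) * cr)⁻¹) * cr)
          + ((((ℓ * (Real.exp 1 * ε)⁻¹ + 2 * (ω + ℓ * d₁)) * R)
                * ((((m₀ + oχ * β) + (m₁ + oχ₁ * β₁ + ct * m₀ + oχ₂ * β)) * cr + 1 * (((m₀ + oχ * β) + (m₁ + oχ₁ * β₁ + ct * m₀ + oχ₂ * β)) * cr) * (R * ((β + (β₁ + ct * β)) * (1 - (β + (β₁ + ct * β)) * (R * cr) * cr)⁻¹) * cr) + (β + (β₁ + ct * β)) * o * cr * ((β + (β₁ + ct * β)) * (1 - (β + (β₁ + ct * β)) * (R * cr) * cr)⁻¹) * cr) * (1 - 1 * ((β + (β₁ + ct * β)) * (R * cr) * cr))⁻¹)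
              + ((ℓ * (Real.exp 1 * ε)⁻¹ + 2 * (ω + ℓ * d₁)) * o + 2 * R * (oo + c₁ / n' + c₁ / n))
                * ((β + (β₁ + ct * β)) * (1 - (β + (β₁ + ct * β)) * (R * cr) * cr)⁻¹)
              + R * (c₁ * ((((m₀ + oχ * β) + (m₁ + oχ₁ * β₁ + ct * m₀ + oχ₂ * β)) * cr + 1 * (((m₀ + oχ * β) + (m₁ + oχ₁ * β₁ + ct * m₀ + oχ₂ * β)) * cr) * (R * ((β + (β₁ + ct * β)) * (1 - (β + (β₁ + ct * β)) * (R * cr) * cr)⁻¹) * cr) + (β + (β₁ + ct * β)) * o * cr * ((β + (β₁ + ct * β)) * (1 - (β + (β₁ + ct * β)) * (R * cr) * cr)⁻¹) * cr) * (1 - 1 * ((β + (β₁ + ct * β)) * (R * cr) * cr))⁻¹)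
                + o₁ * ((β + (β₁ + ct * β)) * (1 - (β + (β₁ + ct * β)) * (R * cr) * cr)⁻¹))
              + o * c₁ * ((β + (β₁ + ct * β)) * (1 - (β + (β₁ + ct * β)) * (R * cr) * cr)⁻¹)) * cr)))) + rFK) * Real.exp (-(ρ₃ * g.dist y y')))) := fun k => by
    rw [hcov k, hcov' k, eC, eC', idef_add]
    exact ((hDK k).add (hDFK k)).mono fun y y' => le_of_eq (by ring)
  have hDEt : ∀ k, HasMaj (BlockNorm.ofBlocks g (liftBlk blk ι)) (BlockNorm.ofBlocks g (liftBlk (blk ∘ π) ι))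
      (idef (pull (liftMap π ι)) (pull (liftMap π ι)) (((-(mulOp (fun p : X' × ι => hX' k p.1) ∘ₗ NL' ∘ₗ mulOp (1 - fun p : X' × ι => χtX' k p.1))) ∘ₗ N' k) ∘ₗ (LinearMap.id + (V' k ∘ₗ stack LinearMap.id (fun j => Sum.elim (fun μ => fgrad n' (liftEquiv (τ' μ) ι)) (fun μ => bgrad n' (liftEquiv (τ' μ) ι)) j)) ∘ₗ (projO none ∘ₗ bgPropV (stack (mulOp (fun p : X' × ι => χtX' k p.1) ∘ₗ N' k) (fun j => Sum.elim (fun μ => fgrad n' (liftEquiv (τ' μ) ι)) (fun μ => bgrad n' (liftEquiv (τ' μ) ι)) j ∘ₗ (mulOp (fun p : X' × ι => χtX' k p.1) ∘ₗ N' k))) (V' k))) + mulOp (fun p : X' × ι => hX' k p.1) ∘ₗ F' k ∘ₗ (projO none ∘ₗ bgPropV (stack (mulOp (fun p : X' × ι => χtX' k p.1) ∘ₗ N' k) (fun j => Sum.elim (fun μ => fgrad n' (liftEquiv (τ' μ) ι)) (fun μ => bgrad n' (liftEquiv (τ' μ) ι)) j ∘ₗ (mulOp (fun p : X' × ι =>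 χtX' k p.1) ∘ₗ N' k))) (V' k))) (((-(mulOp (fun p : X × ι => hX k p.1) ∘ₗ NL ∘ₗ mulOp (1 - fun p : X × ι => χtX k p.1))) ∘ₗ N k) ∘ₗ (LinearMap.id + (V k ∘ₗ stack LinearMap.id (fun j => Sum.elim (fun μ => fgrad n (liftEquiv (τ μ) ι)) (fun μ => bgrad n (liftEquiv (τ μ) ι)) j)) ∘ₗ (projO none ∘ₗ bgPropV (stack (mulOp (fun p : X × ι => χtX k p.1) ∘ₗ N k) (fun j => Sum.elim (fun μ => fgrad n (liftEquiv (τ μ) ι)) (fun μ => bgrad n (liftEquiv (τ μ) ι)) j ∘ₗ (mulOp (fun p : X × ι => χtX k p.1) ∘ₗ N k))) (V k))) + mulOp (fun p : X × ι => hX k p.1) ∘ₗ F k ∘ₗ (projO none ∘ₗ bgPropV (stack (mulOp (fun p : X × ι => χtX k p.1) ∘ₗ N k) (fun j => Sum.elim (fun μ => fgrad n (liftEquiv (τ μ) ι)) (fun μ => bgrad n (liftEquiv (τ μ) ι)) j ∘ₗ (mulOp (fun p : X × ι => χtX k p.1) ∘ₗ N k))) (V k))))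
      (fun y y' => ind (Sk k) y * ((((ε₀ * (R * ((((m₀ + oχ * β) + (m₁ + oχ₁ * β₁ + ct * m₀ + oχ₂ * β)) * cr + 1 * (((m₀ + oχ * β) + (m₁ + oχ₁ * β₁ + ct * m₀ + oχ₂ * β)) * cr) * (R * ((β + (β₁ + ct * β)) * (1 - (β + (β₁ + ct * β)) * (R * cr) * cr)⁻¹) * cr) + (β + (β₁ + ct * β)) * o * cr * ((β + (β₁ + ct * β)) * (1 - (β + (β₁ + ct * β)) * (R * cr) * cr)⁻¹) * cr) * (1 - 1 * ((β + (β₁ + ct * β)) * (R * cr) * cr))⁻¹) + o * ((β + (β₁ + ct * β)) * (1 - (β + (β₁ + ct * β)) * (R * cr) * cr)⁻¹)) * cr * cr + rF * (1 + R * ((β + (β₁ + ct * β)) * (1 - (β + (β₁ + ct * β)) * (R * cr) * cr)⁻¹) * cr * cr))) + rFE) * Real.exp (-(ρ₃ * g.dist y y')))) := fun k => by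
    rw [idef_add]
    exact ((hDE k).add (hDFX k)).mono fun y y' => le_of_eq (by ring)
  exact hasMaj_idef_glued_of_localGauges_fit (blk := blk) (π := π) (S := Sk) (W := ug) (W' := ug') (Δ := Δ) (Δ' := Δ') (hX := hX) (χX := χX) (hX' := hX') (χX' := χX')
    (G' := fun k => projO none ∘ₗ bgPropV (stack (mulOp (fun p : X × ι => χtX k p.1) ∘ₗ N k) (fun j => Sum.elim (fun μ => fgrad n (liftEquiv (τ μ) ι)) (fun μ => bgrad n (liftEquiv (τ μ) ι)) j ∘ₗ (mulOp (fun p : X × ι => χtX k p.1) ∘ₗ N k))) (V k)) (E' := fun k => (((-(mulOp (fun p : X × ι => hX k p.1) ∘ₗ NL ∘ₗ mulOp (1 - fun p : X × ι => χtX k p.1))) ∘ₗ N k) ∘ₗ (LinearMap.id + (V k ∘ₗ stack LinearMap.id (fun j => Sum.elim (fun μ => fgrad n (liftEquiv (τ μ) ι)) (fun μ => bgrad n (liftEquiv (τ μ) ι)) j)) ∘ₗ (projO none ∘ₗ bgPropV (stack (mulOp (fun p : X × ι => χtX k p.1) ∘ₗ N k) (fun j => Sum.elim (fun μ => fgrad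 n (liftEquiv (τ μ) ι)) (fun μ => bgrad n (liftEquiv (τ μ) ι)) j ∘ₗ (mulOp (fun p : X × ι => χtX k p.1) ∘ₗ N k))) (V k))) + mulOp (fun p : X × ι => hX k p.1) ∘ₗ F k ∘ₗ (projO none ∘ₗ bgPropV (stack (mulOp (fun p : X × ι => χtX k p.1) ∘ₗ N k) (fun j => Sum.elim (fun μ => fgrad n (liftEquiv (τ μ) ι)) (fun μ => bgrad n (liftEquiv (τ μ) ι)) j ∘ₗ (mulOp (fun p : X × ι => χtX k p.1) ∘ₗ N k))) (V k))))
    (G'' := fun k => projO none ∘ₗ bgPropV (stack (mulOp (fun p : X' × ι => χtX' k p.1) ∘ₗ N' k) (fun j => Sum.elim (fun μ => fgrad n' (liftEquiv (τ' μ) ι)) (fun μ => bgrad n' (liftEquiv (τ' μ) ι)) j ∘ₗ (mulOp (fun p : X' × ι => χtX' k p.1) ∘ₗ N' k))) (V' k)) (E'' := fun k => (((-(mulOp (fun p : X' × ι => hX' k p.1) ∘ₗ NL' ∘ₗ mulOp (1 - fun p : X' × ι => χtX' k p.1))) ∘ₗ N' k) ∘ₗ (LinearMap.id + (V' k ∘ₗ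 stack LinearMap.id (fun j => Sum.elim (fun μ => fgrad n' (liftEquiv (τ' μ) ι)) (fun μ => bgrad n' (liftEquiv (τ' μ) ι)) j)) ∘ₗ (projO none ∘ₗ bgPropV (stack (mulOp (fun p : X' × ι => χtX' k p.1) ∘ₗ N' k) (fun j => Sum.elim (fun μ => fgrad n' (liftEquiv (τ' μ) ι)) (fun μ => bgrad n' (liftEquiv (τ' μ) ι)) j ∘ₗ (mulOp (fun p : X' × ι => χtX' k p.1) ∘ₗ N' k))) (V' k))) + mulOp (fun p : X' × ι => hX' k p.1) ∘ₗ F' k ∘ₗ (projO none ∘ₗ bgPropV (stack (mulOp (fun p : X' × ι => χtX' k p.1) ∘ₗ N' k) (fun j => Sum.elim (fun μ => fgrad n' (liftEquiv (τ' μ) ι)) (fun μ => bgrad n' (liftEquiv (τ' μ) ι)) j ∘ₗ (mulOp (fun p : X' × ι => χtX' k p.1) ∘ₗ N' k))) (V' k))))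
    htri hd hd0 hrow hσ hcr hug hug' hugf hugf' hB (add_nonneg hθ hθF) (add_nonneg hε' hεF) hAD (add_nonneg hr hrFK) (add_nonneg hrE hrFE) hoo hoW hNov hσρ₃ hfitWT hfitW hhcut hhcut'
    (fun k p => hhabs k p.1) (fun k p => hhabs' k p.1) (fun k p => hfh k p) hN hGc hGc' hKt hKt' hEt hEt' hDGc hDKt hDEt hq'

end Summit.QuantumFields.YangMills.BalabanUVNodes.N15.CurvedSpecies

end
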